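import Summits.AtomisticToContinuum.Crystallization.Theses.SpectralChargeLedger
import Summits.AtomisticToContinuum.Crystallization.Theorems.GappedShellCensusCleanLimitsHaveWindowsLayered
import Summits.AtomisticToContinuum.Crystallization.Theorems.HullExactificationCascadeHullExactShellsShells
import Summits.AtomisticToContinuum.Crystallization.Theorems.HullExactificationCascadeExactHcpLocalTheoremExactify
import Literature.MathematicalPhysics.StatisticalMechanics.LocalMatchingCompactness

/-!
# `SpectralChargeLedger.ShellsToLayers` (stmt-AtomisticToContinuum-17254) — PROVED
# (line `blowup-slot-layering`: blow up to `τ = 0` and land on the landed exact layering)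

`shellsToLayers_proof : SpectralChargeLedger.ShellsToLayers` (sorry-free; axioms `propext`, `Classical.choice`,
`Quot.sound`). The crux (pure geometry; rank 3 of route `SpectralChargeLedger`): for every relaxed Barlow cell
`(a₀, h₀)` in the box, every `δ > 0` and every scale `(R, ε)` there are `τ ∈ (0, 1]` and `R'` such that a site of a
finite δ-separated configuration all of whose neighbours within `R'` have `13/10·a₀`-shells τ-matched (linear
isometry + bijection) to the hcp OR fcc 12-shell at scale `(a₀, h₀)` carries an `(R, ε)`-window of the
`LayeredWindows` format (spacing `a₀`, free Hägg word, increments in `[39a₀/50, 17a₀/20]`).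

PROOF (contrapositive compactness in the local rubber topology; the quantifier order `∀ (R, ε) ∃ (τ, R')` is exactly
its shape). `shellsToLayers_of_closure_exactification_layering : S1 → S2 → S3 → ShellsToLayers`: negate at fixed
`(a₀, h₀, δ, R, ε)`, tolerances `1/(k+1)`, radii `k+1`, recentre the root at `0`, extract a δ-separated local limit
`Y ∋ 0` (`exists_subseq_forall_eventually_ballMatch`, `HullExactShells.zero_mem_of_ballMatch`), apply S1 ⇒ S2 ⇒ S3 to
get `Y = v + A(S(a₀, s, z))`, and hand the window back along the ball match at radius `R + ‖v‖`
(`windowIn_of_layered_ballMatch`, `windowIn_of_windowIn_preimage`), read back through `Set.range y`. The three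
set-level inputs, each proved here from its landed single-letter / relaxed-parameter sibling:

* S1 `goodOfLimit_proof` — SHELL CONGRUENCE (two letters) PASSES TO LOCAL LIMITS: twin of
  `HullExactShells.good_of_limit` (margins of both template shells, `exists_matching_equiv`, `good_transfer`; the
  conclusion inherits the letter of a partner in a good index).
* S2 `exactOfForallGood_proof` — `∀ η > 0`-GOODNESS IS EXACTNESS: one letter recurs as `η ↓ 0` (monotonicity);
  pattern-generic Gram argument `shell_eq_image_of_forall_eta` (`ExactHcpLocal.exists_equiv_forall_eta`,
  `inner_eq_of_forall_eta`, and `exists_isometry_of_gram_frame` on the frame `u, v, w + h₀e₃`, which lies in BOTH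
  template shells, `frame_mem_templateShell`).
* S3 `exactSlotLayering_proof` — EVERYWHERE-EXACT ⇒ EXACTLY LAYERED AT SPACING `a₀`: the dictionary
  `templateShell_hcp/fcc_eq_range_slotH/C` (the punctured open `1.3a₀` template shells ARE the slot models
  `range (slotH/slotC a₀ h₀ h₀)` on the whole box) turns exact shells into the hypotheses `hgap ∧ hexact` of the
  landed `CleanHull` chain at `a := a₀` (`cleanHull_hyps_of_exactShell`, `bondShell_eq_of_exactShell`); a first
  complete layer at spacing EXACTLY `a₀` (`firstLayer_spacing`: `la_walk` with `inplaneStep_of_type` from a rigid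
  site, or `stub_cuboctStep` when every site is cubic at the ideal ratio); then the `ℤ`-recursion of
  `CleanHull.stub_layeredOfExactShells` over `stub_layerStepUp/Down`, KEEPING their step band
  `39/50·a₀ ≤ h ≤ 17/20·a₀`.

The predicates `GoodIn` / `ExactShell` / `ExactlyLayered` / `WindowIn` / `SetForm` are definitionally the inlined
clauses of the crux and of the registered stubs of the line (Cruxes/ShellsToLayers/Lines/blowup_slot_layering.lean;
`*_inlined` restate S1–S3 in the registered signatures verbatim). All `[folklore]` (Baake–Grimm 2013 Rem. 5.6, local
rubber topology; Hales DSP 2012 §1.3, layer propagation). Written by the crux-strategist of 17254, 2026-08-17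
(dictionary lemmas from ideator 2's SketchIdeator2.lean); Theorems/ is prover-only, so this file is attached as the
item's candidate proof for a prover to propose verbatim with `--workitem stmt-AtomisticToContinuum-17254`.
-/

noncomputable section

namespace Summit.AtomisticToContinuum.Crystallization.Theorems.ShellsToLayersBlowup

open scoped Topology
open Filter
open Literature.MathematicalPhysics.StatisticalMechanics
open Summit.AtomisticToContinuum.Crystallization.Theorems.CleanHull
open Summit.AtomisticToContinuum.Crystallization.Theses.SpectralChargeLedger

/-- Euclidean `3`-space. -/
local notation "E3" => EuclideanSpace ℝ (Fin 3)

/-! ## Predicates (definitionally the inlined text of the registered stubs of the line) -/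

/-- The punctured open `13/10·a₀`-shell of the origin in a template set `B` (`hcpStacking a₀ h₀` or
`fccStacking a₀ h₀`): on the box exactly twelve points (six of norm `a₀`, six of norm `√(a₀²/3 + h₀²)`). [folklore] -/
def templateShell (B : Set E3) (a₀ : ℝ) : Set E3 := {q : E3 | q ∈ B ∧ q ≠ 0 ∧ ‖q‖ < 13 / 10 * a₀}

/-- The punctured open `13/10·a₀`-shell of a point `p` in a set `S`. [folklore] -/
def shellIn (S : Set E3) (p : E3) (a₀ : ℝ) : Set E3 := {z : E3 | z ∈ S ∧ z ≠ p ∧ dist z p < 13 / 10 * a₀}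

/-- `τ`-matching of the shell of `p ∈ S` to the template `B` under the linear isometry `A` (a bijection moving
recentred points by `≤ τ`) — the disjunct shape of the route decl. (A predicate, not a fact.) [folklore] -/
def MatchedWith (S : Set E3) (p : E3) (a₀ τ : ℝ) (B : Set E3) (A : E3 →ₗᵢ[ℝ] E3) : Prop :=
  ∃ e : ↥(shellIn S p a₀) ≃ ↥(templateShell B a₀),
    ∀ t : ↥(shellIn S p a₀), dist ((t : E3) - p) (A ((e t : ↥(templateShell B a₀)) : E3)) ≤ τ

/-- `τ`-goodness of a point of a set at scale `(a₀, h₀)` — VERBATIM the crux's hypothesis shape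
`∃ A, (hcp-matched under A) ∨ (fcc-matched under A)` for `S = Set.range y`, `p = y j`. (A predicate, not a fact.) [folklore] -/
def GoodIn (a₀ h₀ τ : ℝ) (S : Set E3) (p : E3) : Prop :=
  ∃ A : E3 →ₗᵢ[ℝ] E3, MatchedWith S p a₀ τ (hcpStacking a₀ h₀) A ∨ MatchedWith S p a₀ τ (fccStacking a₀ h₀) A

/-- EXACT template shell at `p ∈ Z` (the `τ = 0` case): the punctured open `1.3a₀`-shell is a rotated copy
of the hcp or of the fcc template shell, translated to `p`. (A predicate, not a fact.) [folklore] -/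
def ExactShell (a₀ h₀ : ℝ) (Z : Set E3) (p : E3) : Prop :=
  ∃ A : E3 →ₗᵢ[ℝ] E3,
    shellIn Z p a₀ = (fun q => p + A q) '' templateShell (hcpStacking a₀ h₀) a₀ ∨
    shellIn Z p a₀ = (fun q => p + A q) '' templateShell (fccStacking a₀ h₀) a₀

/-- The layered Barlow-type set of the window format (linear isometry `A`, spacing `a₀`, word `s`, heights `z`)
— the `S` of the crux's conclusion. [folklore] -/
def layeredSet (A : E3 →ₗᵢ[ℝ] E3) (a₀ : ℝ) (s : ℤ → ℤ) (z : ℤ → ℝ) : Set E3 :=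
  {q : E3 | ∃ m i j : ℤ, q = A (((i : ℝ) • triangularVec₁ a₀) + ((j : ℝ) • triangularVec₂ a₀) +
    ((haggLabel s m : ℝ) • barlowOffset a₀) + (z m • layerNormal 1))}

/-- `Z` is EXACTLY LAYERED at spacing `a₀`: a translate of a layered set with a Hägg word and increments in
the window band `[39a₀/50, 17a₀/20]`. (Conclusion of S3.) (A predicate, not a fact.) [folklore] -/
def ExactlyLayered (a₀ : ℝ) (Z : Set E3) : Prop :=
  ∃ (A : E3 →ₗᵢ[ℝ] E3) (s : ℤ → ℤ) (z : ℤ → ℝ) (v : E3), IsHaggSeq s ∧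
    (∀ m : ℤ, 39 / 50 * a₀ ≤ z (m + 1) - z m ∧ z (m + 1) - z m ≤ 17 / 20 * a₀) ∧
    Z = (fun q => q + v) '' layeredSet A a₀ s z

/-- The `(R, ε)`-window of the crux for a set `S` (two-way `ε`-match of `S + t` with a layered set on
`B(0, R)`). (A predicate, not a fact.) [folklore] -/
def WindowIn (a₀ R ε : ℝ) (S : Set E3) : Prop :=
  ∃ (A : E3 →ₗᵢ[ℝ] E3) (t : E3) (s : ℤ → ℤ) (z : ℤ → ℝ), IsHaggSeq s ∧
    (∀ m : ℤ, 39 / 50 * a₀ ≤ z (m + 1) - z m ∧ z (m + 1) - z m ≤ 17 / 20 * a₀) ∧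
    (∀ p ∈ layeredSet A a₀ s z, ‖p‖ ≤ R → ∃ q ∈ S, dist (q + t) p ≤ ε) ∧
    (∀ q ∈ S, ‖q + t‖ ≤ R → ∃ p ∈ layeredSet A a₀ s z, dist (q + t) p ≤ ε)

/-- The parameter box of the route. (A predicate, not a fact.) [folklore] -/
def InBox (a₀ h₀ : ℝ) : Prop := 47 / 50 ≤ a₀ ∧ a₀ ≤ 1 ∧ |h₀ - a₀ * Real.sqrt (2 / 3)| ≤ a₀ / 100

/-- Set form of the crux (configurations enter only through `Set.range y`). (A predicate, not a fact.) [folklore] -/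
def SetForm : Prop :=
  ∀ a₀ h₀ : ℝ, InBox a₀ h₀ → ∀ δ : ℝ, 0 < δ → ∀ R ε : ℝ, 0 < ε → ∃ τ R' : ℝ, 0 < τ ∧ τ ≤ 1 ∧
    ∀ S : Set E3, S.Finite → (∀ p ∈ S, ∀ q ∈ S, p ≠ q → δ ≤ dist p q) →
      ∀ p ∈ S, (∀ q ∈ S, dist q p ≤ R' → GoodIn a₀ h₀ τ S q) → WindowIn a₀ R ε S

/-! ## The contrapositive compactness argument -/

/-- Goodness is translation covariant (each disjunct through the landed
`HullExactShells.good_preimage_add_const`). [folklore] -/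
theorem goodIn_preimage_add_const {a₀ h₀ τ : ℝ} {S : Set E3} {q : E3} (c : E3)
    (h : GoodIn a₀ h₀ τ S (q + c)) : GoodIn a₀ h₀ τ ((fun w => w + c) ⁻¹' S) q := by
  obtain ⟨A, hA | hA⟩ := h
  · obtain ⟨A', e', h'⟩ :=
      Summit.AtomisticToContinuum.Crystallization.Theorems.HullExactShells.good_preimage_add_const
        (X := S) (P := templateShell (hcpStacking a₀ h₀) a₀) (z := q) (r := 13 / 10 * a₀) (η := τ) c ⟨A, hA⟩
    exact ⟨A', Or.inl ⟨e', h'⟩⟩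
  · obtain ⟨A', e', h'⟩ :=
      Summit.AtomisticToContinuum.Crystallization.Theorems.HullExactShells.good_preimage_add_const
        (X := S) (P := templateShell (fccStacking a₀ h₀) a₀) (z := q) (r := 13 / 10 * a₀) (η := τ) c ⟨A, hA⟩
    exact ⟨A', Or.inr ⟨e', h'⟩⟩

/-- Window transfer: an exactly layered translate `Y = S + v`, two-way `ε`-matched with `Y'` on the ball of
radius `R + ‖v‖`, hands the `(R, ε)`-window to `Y'` (translation `−v`). [folklore] -/
theorem windowIn_of_layered_ballMatch {a₀ R ε : ℝ} {Y Y' : Set E3} {A : E3 →ₗᵢ[ℝ] E3} {s : ℤ → ℤ}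
    {z : ℤ → ℝ} {v : E3} (hs : IsHaggSeq s)
    (hz : ∀ m : ℤ, 39 / 50 * a₀ ≤ z (m + 1) - z m ∧ z (m + 1) - z m ≤ 17 / 20 * a₀)
    (hY : Y = (fun q => q + v) '' layeredSet A a₀ s z)
    (hM : BallMatch ε (R + ‖v‖) 0 Y' Y) : WindowIn a₀ R ε Y' := by
  refine ⟨A, -v, s, z, hs, hz, ?_, ?_⟩
  · intro p hp hpR
    have hpv : p + v ∈ Y := by rw [hY]; exact ⟨p, hp, rfl⟩
    have hR' : dist (p + v) 0 ≤ R + ‖v‖ := by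
      rw [dist_zero_right]; exact (norm_add_le p v).trans (by linarith)
    obtain ⟨a, ha, hap⟩ := hM.1 (p + v) hpv hR'
    refine ⟨a, ha, ?_⟩
    have e1 : dist (a + -v) p = dist a (p + v) := by
      rw [← dist_add_right (a + -v) p v]; congr 1; abel
    rw [e1]; exact hap
  · intro q hq hqR
    have hR' : dist q 0 ≤ R + ‖v‖ := by
      rw [dist_zero_right]
      have h1 : ‖q‖ ≤ ‖q + -v‖ + ‖v‖ :=
        calc ‖q‖ = ‖(q + -v) + v‖ := by congr 1; abel
          _ ≤ ‖q + -v‖ + ‖v‖ := norm_add_le _ _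
      linarith
    obtain ⟨y, hy, hqy⟩ := hM.2 q hq hR'
    rw [hY] at hy
    obtain ⟨p, hp, rfl⟩ := hy
    refine ⟨p, hp, ?_⟩
    have e1 : dist (q + -v) p = dist q (p + v) := by
      rw [← dist_add_right (q + -v) p v]; congr 1; abel
    rw [e1]; exact hqy

/-- Windows are translation covariant: a window of `S - c = (· + c) ⁻¹' S` with translation `t` is a window
of `S` with translation `t - c`. [folklore] -/
theorem windowIn_of_windowIn_preimage {a₀ R ε : ℝ} {S : Set E3} (c : E3)
    (h : WindowIn a₀ R ε ((fun w => w + c) ⁻¹' S)) : WindowIn a₀ R ε S := by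
  obtain ⟨A, t, s, z, hs, hz, h1, h2⟩ := h
  refine ⟨A, t - c, s, z, hs, hz, ?_, ?_⟩
  · intro p hp hpR
    obtain ⟨q, hq, hqp⟩ := h1 p hp hpR
    refine ⟨q + c, hq, ?_⟩
    have e1 : q + c + (t - c) = q + t := by abel
    rw [e1]; exact hqp
  · intro q hq hqR
    have hq' : q - c ∈ (fun w => w + c) ⁻¹' S := by
      show q - c + c ∈ S
      rw [sub_add_cancel]; exact hq
    have e1 : q - c + t = q + (t - c) := by abel
    obtain ⟨p, hp, hpq⟩ := h2 (q - c) hq' (by rw [e1]; exact hqR)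
    exact ⟨p, hp, by rw [← e1]; exact hpq⟩

/-- **The contrapositive compactness argument.** S1, S2, S3 (in readable form, definitionally the registered
signatures) imply the set form of the crux. [folklore] -/
theorem setForm_of
    (h1 : ∀ (a₀ h₀ δ : ℝ), 47 / 50 ≤ a₀ → a₀ ≤ 1 → |h₀ - a₀ * Real.sqrt (2 / 3)| ≤ a₀ / 100 →
      0 < δ → ∀ (Ys : ℕ → Set E3) (Y : Set E3) (τ ρ : ℕ → ℝ),
        (∀ k : ℕ, ∀ p ∈ Ys k, ∀ q ∈ Ys k, p ≠ q → δ ≤ dist p q) →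
        (∀ p ∈ Y, ∀ q ∈ Y, p ≠ q → δ ≤ dist p q) →
        (∀ k : ℕ, ∀ q ∈ Ys k, ‖q‖ ≤ ρ k → GoodIn a₀ h₀ (τ k) (Ys k) q) →
        Tendsto τ atTop (𝓝 0) → Tendsto ρ atTop atTop →
        (∀ R ε : ℝ, 0 < ε → ∀ᶠ k : ℕ in atTop, BallMatch ε R 0 (Ys k) Y) →
        ∀ p ∈ Y, ∀ η : ℝ, 0 < η → GoodIn a₀ h₀ η Y p)
    (h2 : ∀ (a₀ h₀ δ : ℝ), 47 / 50 ≤ a₀ → a₀ ≤ 1 → |h₀ - a₀ * Real.sqrt (2 / 3)| ≤ a₀ / 100 →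
      0 < δ → ∀ (Y : Set E3), (∀ p ∈ Y, ∀ q ∈ Y, p ≠ q → δ ≤ dist p q) →
        ∀ p ∈ Y, (∀ η : ℝ, 0 < η → GoodIn a₀ h₀ η Y p) → ExactShell a₀ h₀ Y p)
    (h3 : ∀ (a₀ h₀ : ℝ), 47 / 50 ≤ a₀ → a₀ ≤ 1 → |h₀ - a₀ * Real.sqrt (2 / 3)| ≤ a₀ / 100 →
      ∀ (Z : Set E3), Z.Nonempty → (∀ p ∈ Z, ExactShell a₀ h₀ Z p) → ExactlyLayered a₀ Z) :
    SetForm := by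
  intro a₀ h₀ hb δ hδ R ε hε
  obtain ⟨ha, ha', hh⟩ := hb
  by_contra hcon
  -- a failing family: tolerance `1/(k+1)`, radius `k+1`
  have hbad : ∀ k : ℕ, ∃ (S : Set E3) (c : E3), S.Finite ∧ (∀ p ∈ S, ∀ q ∈ S, p ≠ q → δ ≤ dist p q) ∧
      c ∈ S ∧ (∀ q ∈ S, dist q c ≤ (k : ℝ) + 1 → GoodIn a₀ h₀ (1 / ((k : ℝ) + 1)) S q) ∧
      ¬ WindowIn a₀ R ε S := by
    intro k
    by_contra hk
    apply hcon
    refine ⟨1 / ((k : ℝ) + 1), (k : ℝ) + 1, by positivity, ?_, ?_⟩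
    · rw [div_le_one (by positivity)]
      have h0 : (0 : ℝ) ≤ k := Nat.cast_nonneg k
      linarith
    · intro S hS hsep c hc hgood
      by_contra hw
      exact hk ⟨S, c, hS, hsep, hc, hgood, hw⟩
  choose S c hSfin hSsep hcS hSgood hSwin using hbad
  -- recentre the roots at the origin
  set Ys : ℕ → Set E3 := fun k => (fun w => w + c k) ⁻¹' S k with hYs
  have hYsep : ∀ k, ∀ p ∈ Ys k, ∀ q ∈ Ys k, p ≠ q → δ ≤ dist p q := fun k =>
    Summit.AtomisticToContinuum.Crystallization.Theorems.HullExactShells.sep_preimage_add_const (hSsep k) (c k)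
  have h0 : ∀ k, (0 : E3) ∈ Ys k := fun k => by
    show (0 : E3) + c k ∈ S k
    rw [zero_add]; exact hcS k
  have hYgood : ∀ k, ∀ q ∈ Ys k, ‖q‖ ≤ (k : ℝ) + 1 →
      GoodIn a₀ h₀ (1 / ((k : ℝ) + 1)) (Ys k) q := by
    intro k q hq hqn
    apply goodIn_preimage_add_const
    apply hSgood k (q + c k) hq
    rw [dist_eq_norm, add_sub_cancel_right]; exact hqn
  -- local limit in the local rubber topology
  obtain ⟨φ, Y, hφ, hYsep', hlim⟩ := exists_subseq_forall_eventually_ballMatch hδ Ys hYsep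
  have h0Y : (0 : E3) ∈ Y :=
    Summit.AtomisticToContinuum.Crystallization.Theorems.HullExactShells.zero_mem_of_ballMatch hδ hYsep'
      (Eventually.of_forall fun k => h0 (φ k)) hlim
  have hτ : Tendsto (fun k => 1 / (((φ k : ℕ) : ℝ) + 1)) atTop (𝓝 0) :=
    (tendsto_one_div_add_atTop_nhds_zero_nat (𝕜 := ℝ)).comp hφ.tendsto_atTop
  have hρ : Tendsto (fun k => ((φ k : ℕ) : ℝ) + 1) atTop atTop :=
    tendsto_atTop_add_const_right _ 1 (tendsto_natCast_atTop_atTop.comp hφ.tendsto_atTop)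
  -- S1: every point of the limit is good for every tolerance
  have hgoodY : ∀ p ∈ Y, ∀ η : ℝ, 0 < η → GoodIn a₀ h₀ η Y p :=
    h1 a₀ h₀ δ ha ha' hh hδ (fun k => Ys (φ k)) Y (fun k => 1 / (((φ k : ℕ) : ℝ) + 1))
      (fun k => ((φ k : ℕ) : ℝ) + 1) (fun k => hYsep (φ k)) hYsep' (fun k => hYgood (φ k)) hτ hρ hlim
  -- S2: hence exact; S3: hence exactly layered
  have hexact : ∀ p ∈ Y, ExactShell a₀ h₀ Y p := fun p hp =>
    h2 a₀ h₀ δ ha ha' hh hδ Y hYsep' p hp (hgoodY p hp)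
  obtain ⟨A, s, z, v, hs, hz, hYeq⟩ := h3 a₀ h₀ ha ha' hh Y ⟨0, h0Y⟩ hexact
  -- transfer the window back along the ball match
  obtain ⟨k, hk⟩ := (hlim (R + ‖v‖) ε hε).exists
  have hwin : WindowIn a₀ R ε (Ys (φ k)) := windowIn_of_layered_ballMatch hs hz hYeq hk
  exact hSwin (φ k) (windowIn_of_windowIn_preimage (c (φ k)) hwin)

/-- **`ShellsToLayers` from limit closure, exactification and exact layering.** The three registered stub
STATEMENTS of the line `blowup-slot-layering` (fully inlined, verbatim the registered signatures of
`stub_goodOfLimit`, `stub_exactOfForallGood`, `stub_exactSlotLayering` on stmt-AtomisticToContinuum-17254) imply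
the crux `SpectralChargeLedger.ShellsToLayers`: contrapositive compactness in the local rubber topology
(`setForm_of`) and the read-back through `Set.range y`. [folklore] -/
theorem shellsToLayers_of_closure_exactification_layering
    (h1 : ∀ (a₀ h₀ δ : ℝ), 47 / 50 ≤ a₀ → a₀ ≤ 1 → |h₀ - a₀ * Real.sqrt (2 / 3)| ≤ a₀ / 100 → 0 < δ → ∀ (Ys : ℕ → Set (EuclideanSpace ℝ (Fin 3))) (Y : Set (EuclideanSpace ℝ (Fin 3))) (τ ρ : ℕ → ℝ), (∀ k : ℕ, ∀ p ∈ Ys k, ∀ q ∈ Ys k, p ≠ q → δ ≤ dist p q) → (∀ p ∈ Y, ∀ q ∈ Y, p ≠ q → δ ≤ dist p q) → (∀ k : ℕ, ∀ q ∈ Ys k, ‖q‖ ≤ ρ k → (∃ A : EuclideanSpace ℝ (Fin 3) →ₗᵢ[ℝ] EuclideanSpace ℝ (Fin 3), (∃ e : ↥{z : EuclideanSpace ℝ (Fin 3) | z ∈ Ys k ∧ z ≠ q ∧ dist z q < 13 / 10 * a₀} ≃ ↥{q : EuclideanSpace ℝ (Fin 3) | q ∈ Literature.MathematicalPhysics.StatisticalMechanics.hcpStacking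 a₀ h₀ ∧ q ≠ 0 ∧ ‖q‖ < 13 / 10 * a₀}, ∀ t : ↥{z : EuclideanSpace ℝ (Fin 3) | z ∈ Ys k ∧ z ≠ q ∧ dist z q < 13 / 10 * a₀}, dist ((t : EuclideanSpace ℝ (Fin 3)) - q) (A ((e t : ↥{q : EuclideanSpace ℝ (Fin 3) | q ∈ Literature.MathematicalPhysics.StatisticalMechanics.hcpStacking a₀ h₀ ∧ q ≠ 0 ∧ ‖q‖ < 13 / 10 * a₀}) : EuclideanSpace ℝ (Fin 3))) ≤ τ k) ∨ (∃ e : ↥{z : EuclideanSpace ℝ (Fin 3) | z ∈ Ys k ∧ z ≠ q ∧ dist z q < 13 / 10 * a₀} ≃ ↥{q : EuclideanSpace ℝ (Fin 3) | q ∈ Literature.MathematicalPhysics.StatisticalMechanics.fccStacking a₀ h₀ ∧ q ≠ 0 ∧ ‖q‖ < 13 / 10 * a₀}, ∀ t : ↥{z : EuclideanSpace ℝ (Fin 3) | z ∈ Ys k ∧ z ≠ q ∧ dist z q < 13 / 10 * a₀}, dist ((t : EuclideanSpace ℝ (Fin 3)) - q) (A ((e t : ↥{q : EuclideanSpace ℝ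 (Fin 3) | q ∈ Literature.MathematicalPhysics.StatisticalMechanics.fccStacking a₀ h₀ ∧ q ≠ 0 ∧ ‖q‖ < 13 / 10 * a₀}) : EuclideanSpace ℝ (Fin 3))) ≤ τ k))) → Filter.Tendsto τ Filter.atTop (nhds 0) → Filter.Tendsto ρ Filter.atTop Filter.atTop → (∀ R ε : ℝ, 0 < ε → ∀ᶠ k : ℕ in Filter.atTop, Literature.MathematicalPhysics.StatisticalMechanics.BallMatch ε R 0 (Ys k) Y) → ∀ p ∈ Y, ∀ η : ℝ, 0 < η → (∃ A : EuclideanSpace ℝ (Fin 3) →ₗᵢ[ℝ] EuclideanSpace ℝ (Fin 3), (∃ e : ↥{z : EuclideanSpace ℝ (Fin 3) | z ∈ Y ∧ z ≠ p ∧ dist z p < 13 / 10 * a₀} ≃ ↥{q : EuclideanSpace ℝ (Fin 3) | q ∈ Literature.MathematicalPhysics.StatisticalMechanics.hcpStacking a₀ h₀ ∧ q ≠ 0 ∧ ‖q‖ < 13 / 10 * a₀}, ∀ t : ↥{z : EuclideanSpace ℝ (Fin 3) | z ∈ Y ∧ z ≠ p ∧ dist z p < 13 / 10 * a₀}, dist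 ((t : EuclideanSpace ℝ (Fin 3)) - p) (A ((e t : ↥{q : EuclideanSpace ℝ (Fin 3) | q ∈ Literature.MathematicalPhysics.StatisticalMechanics.hcpStacking a₀ h₀ ∧ q ≠ 0 ∧ ‖q‖ < 13 / 10 * a₀}) : EuclideanSpace ℝ (Fin 3))) ≤ η) ∨ (∃ e : ↥{z : EuclideanSpace ℝ (Fin 3) | z ∈ Y ∧ z ≠ p ∧ dist z p < 13 / 10 * a₀} ≃ ↥{q : EuclideanSpace ℝ (Fin 3) | q ∈ Literature.MathematicalPhysics.StatisticalMechanics.fccStacking a₀ h₀ ∧ q ≠ 0 ∧ ‖q‖ < 13 / 10 * a₀}, ∀ t : ↥{z : EuclideanSpace ℝ (Fin 3) | z ∈ Y ∧ z ≠ p ∧ dist z p < 13 / 10 * a₀}, dist ((t : EuclideanSpace ℝ (Fin 3)) - p) (A ((e t : ↥{q : EuclideanSpace ℝ (Fin 3) | q ∈ Literature.MathematicalPhysics.StatisticalMechanics.fccStacking a₀ h₀ ∧ q ≠ 0 ∧ ‖q‖ < 13 / 10 * a₀}) : EuclideanSpace ℝ (Fin 3))) ≤ η)))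
    (h2 : ∀ (a₀ h₀ δ : ℝ), 47 / 50 ≤ a₀ → a₀ ≤ 1 → |h₀ - a₀ * Real.sqrt (2 / 3)| ≤ a₀ / 100 → 0 < δ → ∀ (Y : Set (EuclideanSpace ℝ (Fin 3))), (∀ p ∈ Y, ∀ q ∈ Y, p ≠ q → δ ≤ dist p q) → ∀ p ∈ Y, (∀ η : ℝ, 0 < η → (∃ A : EuclideanSpace ℝ (Fin 3) →ₗᵢ[ℝ] EuclideanSpace ℝ (Fin 3), (∃ e : ↥{z : EuclideanSpace ℝ (Fin 3) | z ∈ Y ∧ z ≠ p ∧ dist z p < 13 / 10 * a₀} ≃ ↥{q : EuclideanSpace ℝ (Fin 3) | q ∈ Literature.MathematicalPhysics.StatisticalMechanics.hcpStacking a₀ h₀ ∧ q ≠ 0 ∧ ‖q‖ < 13 / 10 * a₀}, ∀ t : ↥{z : EuclideanSpace ℝ (Fin 3) | z ∈ Y ∧ z ≠ p ∧ dist z p < 13 / 10 * a₀}, dist ((t : EuclideanSpace ℝ (Fin 3)) - p) (A ((e t : ↥{q : EuclideanSpace ℝ (Fin 3) | q ∈ Literature.MathematicalPhysics.StatisticalMechanics.hcpStacking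 a₀ h₀ ∧ q ≠ 0 ∧ ‖q‖ < 13 / 10 * a₀}) : EuclideanSpace ℝ (Fin 3))) ≤ η) ∨ (∃ e : ↥{z : EuclideanSpace ℝ (Fin 3) | z ∈ Y ∧ z ≠ p ∧ dist z p < 13 / 10 * a₀} ≃ ↥{q : EuclideanSpace ℝ (Fin 3) | q ∈ Literature.MathematicalPhysics.StatisticalMechanics.fccStacking a₀ h₀ ∧ q ≠ 0 ∧ ‖q‖ < 13 / 10 * a₀}, ∀ t : ↥{z : EuclideanSpace ℝ (Fin 3) | z ∈ Y ∧ z ≠ p ∧ dist z p < 13 / 10 * a₀}, dist ((t : EuclideanSpace ℝ (Fin 3)) - p) (A ((e t : ↥{q : EuclideanSpace ℝ (Fin 3) | q ∈ Literature.MathematicalPhysics.StatisticalMechanics.fccStacking a₀ h₀ ∧ q ≠ 0 ∧ ‖q‖ < 13 / 10 * a₀}) : EuclideanSpace ℝ (Fin 3))) ≤ η))) → (∃ A : EuclideanSpace ℝ (Fin 3) →ₗᵢ[ℝ] EuclideanSpace ℝ (Fin 3), {z : EuclideanSpace ℝ (Fin 3) | z ∈ Y ∧ z ≠ p ∧ dist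 z p < 13 / 10 * a₀} = (fun q => p + A q) '' {q : EuclideanSpace ℝ (Fin 3) | q ∈ Literature.MathematicalPhysics.StatisticalMechanics.hcpStacking a₀ h₀ ∧ q ≠ 0 ∧ ‖q‖ < 13 / 10 * a₀} ∨ {z : EuclideanSpace ℝ (Fin 3) | z ∈ Y ∧ z ≠ p ∧ dist z p < 13 / 10 * a₀} = (fun q => p + A q) '' {q : EuclideanSpace ℝ (Fin 3) | q ∈ Literature.MathematicalPhysics.StatisticalMechanics.fccStacking a₀ h₀ ∧ q ≠ 0 ∧ ‖q‖ < 13 / 10 * a₀}))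
    (h3 : ∀ (a₀ h₀ : ℝ), 47 / 50 ≤ a₀ → a₀ ≤ 1 → |h₀ - a₀ * Real.sqrt (2 / 3)| ≤ a₀ / 100 → ∀ (Z : Set (EuclideanSpace ℝ (Fin 3))), Z.Nonempty → (∀ p ∈ Z, (∃ A : EuclideanSpace ℝ (Fin 3) →ₗᵢ[ℝ] EuclideanSpace ℝ (Fin 3), {z : EuclideanSpace ℝ (Fin 3) | z ∈ Z ∧ z ≠ p ∧ dist z p < 13 / 10 * a₀} = (fun q => p + A q) '' {q : EuclideanSpace ℝ (Fin 3) | q ∈ Literature.MathematicalPhysics.StatisticalMechanics.hcpStacking a₀ h₀ ∧ q ≠ 0 ∧ ‖q‖ < 13 / 10 * a₀} ∨ {z : EuclideanSpace ℝ (Fin 3) | z ∈ Z ∧ z ≠ p ∧ dist z p < 13 / 10 * a₀} = (fun q => p + A q) '' {q : EuclideanSpace ℝ (Fin 3) | q ∈ Literature.MathematicalPhysics.StatisticalMechanics.fccStacking a₀ h₀ ∧ q ≠ 0 ∧ ‖q‖ < 13 / 10 * a₀})) → (∃ (A : EuclideanSpace ℝ (Fin 3) →ₗᵢ[ℝ]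 EuclideanSpace ℝ (Fin 3)) (s : ℤ → ℤ) (z : ℤ → ℝ) (v : EuclideanSpace ℝ (Fin 3)), Literature.MathematicalPhysics.StatisticalMechanics.IsHaggSeq s ∧ (∀ m : ℤ, 39 / 50 * a₀ ≤ z (m + 1) - z m ∧ z (m + 1) - z m ≤ 17 / 20 * a₀) ∧ Z = (fun q => q + v) '' {q : EuclideanSpace ℝ (Fin 3) | ∃ m i j : ℤ, q = A (((i : ℝ) • Literature.MathematicalPhysics.StatisticalMechanics.triangularVec₁ a₀) + ((j : ℝ) • Literature.MathematicalPhysics.StatisticalMechanics.triangularVec₂ a₀) + ((Literature.MathematicalPhysics.StatisticalMechanics.haggLabel s m : ℝ) • Literature.MathematicalPhysics.StatisticalMechanics.barlowOffset a₀) + (z m • Literature.MathematicalPhysics.StatisticalMechanics.layerNormal 1))})) :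
    Summit.AtomisticToContinuum.Crystallization.Theses.SpectralChargeLedger.ShellsToLayers := by
  intro a₀ h₀ ha ha' hh δ hδ R ε hε
  obtain ⟨τ, R', hτ, hτ1, hmain⟩ := setForm_of h1 h2 h3 a₀ h₀ ⟨ha, ha', hh⟩ δ hδ R ε hε
  refine ⟨τ, R', hτ, hτ1, fun N y hsep i hgood => ?_⟩
  have hsepS : ∀ p ∈ Set.range y, ∀ q ∈ Set.range y, p ≠ q → δ ≤ dist p q := by
    rintro _ ⟨k, rfl⟩ _ ⟨l, rfl⟩ hkl
    exact hsep k l fun h' => hkl (by rw [h'])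
  have hgoodS : ∀ q ∈ Set.range y, dist q (y i) ≤ R' → GoodIn a₀ h₀ τ (Set.range y) q := by
    rintro _ ⟨j, rfl⟩ hj
    exact hgood j hj
  obtain ⟨A, t, s, z, hs, hz, h1', h2'⟩ :=
    hmain (Set.range y) (Set.finite_range y) hsepS (y i) (Set.mem_range_self i) hgoodS
  refine ⟨A, t, s, z, hs, hz, ?_, ?_⟩
  · intro p hp hpR
    obtain ⟨_, ⟨k, rfl⟩, hk⟩ := h1' p hp hpR
    exact ⟨k, hk⟩
  · intro k hk
    obtain ⟨p, hp, hpk⟩ := h2' (y k) (Set.mem_range_self k) hk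
    exact ⟨p, hp, hpk⟩


/-! ## Groundwork for `stub_exactSlotLayering` (from ideator 2, SketchIdeator2.lean, r1):
   the dictionary "template shell on the box = `range (slotH/slotC a₀ h₀ h₀)`" and
   "exact shells everywhere ⇒ the hypotheses `hgap ∧ hexact` of `CleanHull.stub_firstLayer/StepUp/StepDown` at `a := a₀`". -/

/-- Decimal bounds `0.8164 < √(2/3) < 0.8166`. [folklore] -/
theorem sqrt_two_thirds_bounds : (8164 / 10000 : ℝ) < Real.sqrt (2 / 3) ∧ Real.sqrt (2 / 3) < 8166 / 10000 := by
  constructor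
  · rw [Real.lt_sqrt (by norm_num)]; norm_num
  · rw [Real.sqrt_lt' (by norm_num)]; norm_num

/-- On the box: `0 < a₀` and `0.806·a₀ ≤ h₀ ≤ 0.827·a₀`. [folklore] -/
theorem InBox.bounds {a₀ h₀ : ℝ} (hb : InBox a₀ h₀) :
    0 < a₀ ∧ 806 / 1000 * a₀ ≤ h₀ ∧ h₀ ≤ 827 / 1000 * a₀ := by
  obtain ⟨ha, ha', hh⟩ := hb
  obtain ⟨h1, h2⟩ := abs_le.1 hh
  obtain ⟨l, u⟩ := sqrt_two_thirds_bounds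
  refine ⟨by linarith, ?_, ?_⟩ <;> nlinarith

/-- `barlowPos` through the integer atlas for the three central layers. [folklore] -/
theorem barlowPos_eq_laPt (a h : ℝ) (s : ℤ → ℤ) {k : ℤ} (hk : k = -1 ∨ k = 0 ∨ k = 1) (i j : ℤ) :
    barlowPos a h s k i j = laPt a h h (3 * i + haggLabel s k, 3 * j + haggLabel s k, k) := by
  ext l
  fin_cases l
  · simp [laPt, triangularVec₁, triangularVec₂, layerNormal]
    ring
  · simp [laPt, triangularVec₁, triangularVec₂, layerNormal]
    ring
  · rcases hk with rfl | rfl | rfl <;> simp [laPt, laHt, triangularVec₁, triangularVec₂, layerNormal]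

/-- The vertical coordinate bounds the norm from below. [folklore] -/
theorem abs_mul_le_norm_barlowPos (a h : ℝ) (s : ℤ → ℤ) (k i j : ℤ) :
    |(k : ℝ) * h| ≤ ‖barlowPos a h s k i j‖ := by
  have := PiLp.dist_apply_le (barlowPos a h s k i j) (0 : E3) 2
  simpa [Real.dist_eq] using this

/-- Layer/in-plane indices `(k, i, j)` of the twelve hcp slots. [folklore] -/
def hcpIdx : Fin 12 → ℤ × ℤ × ℤ :=
  ![(0, 1, 0), (0, -1, 0), (0, 0, 1), (0, 0, -1), (0, 1, -1), (0, -1, 1),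
    (1, 0, 0), (1, -1, 0), (1, 0, -1), (-1, 0, 0), (-1, -1, 0), (-1, 0, -1)]

/-- The hcp slot indices have layer `k ∈ {-1, 0, 1}` and match the integer atlas `laCodeH`. [folklore] -/
theorem hcpIdx_spec (m : Fin 12) : ((hcpIdx m).1 = -1 ∨ (hcpIdx m).1 = 0 ∨ (hcpIdx m).1 = 1) ∧
    laCodeH m = (3 * (hcpIdx m).2.1 + (if (hcpIdx m).1 = 0 then 0 else 1),
      3 * (hcpIdx m).2.2 + (if (hcpIdx m).1 = 0 then 0 else 1), (hcpIdx m).1) := by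
  revert m; decide

/-- **Dictionary, hcp.** On the box the punctured open `1.3a₀`-shell of the origin in `hcpStacking a₀ h₀` IS `range (slotH a₀ h₀ h₀)` (eclipsed triangles: layers `±1` of the alternating word both carry label `1`). [folklore] -/
theorem templateShell_hcp_eq_range_slotH {a₀ h₀ : ℝ} (hb : InBox a₀ h₀) :
    templateShell (hcpStacking a₀ h₀) a₀ = Set.range (slotH a₀ h₀ h₀) := by
  obtain ⟨ha0, hlo, hhi⟩ := hb.bounds
  have hh0 : 0 < h₀ := by linarith
  ext p
  simp only [templateShell, Set.mem_setOf_eq, Set.mem_range, hcpStacking, barlowStacking]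
  constructor
  · rintro ⟨⟨k, i, j, rfl⟩, hne, hnorm⟩
    -- the layer index is -1, 0 or 1
    have hz := abs_mul_le_norm_barlowPos a₀ h₀ alternatingHagg k i j
    have h1 : |(k : ℝ)| * h₀ < 13 / 10 * a₀ := by
      rw [abs_mul, abs_of_pos hh0] at hz
      exact hz.trans_lt hnorm
    have h2 : |(k : ℝ)| < 2 := by
      nlinarith [mul_nonneg (abs_nonneg (k : ℝ)) (sub_nonneg.2 hlo), abs_nonneg (k : ℝ)]
    have h3 : |k| < 2 := by exact_mod_cast h2
    have hk : k = -1 ∨ k = 0 ∨ k = 1 := by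
      rcases abs_lt.1 h3 with ⟨h4, h5⟩
      omega
    have hsq : ‖barlowPos a₀ h₀ alternatingHagg k i j‖ ^ 2 < (13 / 10 * a₀) ^ 2 :=
      pow_lt_pow_left₀ hnorm (norm_nonneg _) two_ne_zero
    rw [barlowPos_eq_laPt a₀ h₀ alternatingHagg hk] at hsq hne ⊢
    rw [norm_laPt_sq] at hsq
    rcases hk with rfl | rfl | rfl
    · -- k = -1, label 1
      have hL : haggLabel alternatingHagg (-1) = 1 := by rw [haggLabel_alternating]; decide
      rw [hL] at hsq hne ⊢
      simp only [laHt] at hsq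
      norm_num at hsq
      have hQ : (i : ℝ) ^ 2 + i * j + j ^ 2 + i + j < 71 / 100 := by nlinarith
      have hQ' : i ^ 2 + i * j + j ^ 2 + i + j ≤ 0 := by
        have : ((i ^ 2 + i * j + j ^ 2 + i + j : ℤ) : ℝ) < 1 := by push_cast; linarith
        have : i ^ 2 + i * j + j ^ 2 + i + j < 1 := by exact_mod_cast this
        omega
      have hj1 : 3 * j ^ 2 + 2 * j - 1 ≤ 0 := by nlinarith [sq_nonneg (2 * i + j + 1)]
      have hi1 : 3 * i ^ 2 + 2 * i - 1 ≤ 0 := by nlinarith [sq_nonneg (2 * j + i + 1)]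
      have hj2 : -1 ≤ j := by nlinarith
      have hj3 : j ≤ 0 := by nlinarith
      have hi2 : -1 ≤ i := by nlinarith
      have hi3 : i ≤ 0 := by nlinarith
      interval_cases i <;> interval_cases j
      · norm_num at hQ'
      · exact ⟨10, by rw [slotH_eq_laPt]; exact congrArg _ (by decide)⟩
      · exact ⟨11, by rw [slotH_eq_laPt]; exact congrArg _ (by decide)⟩
      · exact ⟨9, by rw [slotH_eq_laPt]; exact congrArg _ (by decide)⟩
    · -- k = 0, label 0
      have hL : haggLabel alternatingHagg 0 = 0 := by simp
      rw [hL] at hsq hne ⊢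
      simp only [laHt] at hsq
      norm_num at hsq
      have hQ : (i : ℝ) ^ 2 + i * j + j ^ 2 < 169 / 100 := by nlinarith
      have hQ' : i ^ 2 + i * j + j ^ 2 ≤ 1 := by
        have : ((i ^ 2 + i * j + j ^ 2 : ℤ) : ℝ) < 2 := by push_cast; linarith
        have : i ^ 2 + i * j + j ^ 2 < 2 := by exact_mod_cast this
        omega
      have hne' : (i, j) ≠ (0, 0) := by
        rintro ⟨⟩
        apply hne
        simp [laPt, laHt]
      have hQ1 : 1 ≤ i ^ 2 + i * j + j ^ 2 := one_le_sq_add_mul_add_sq (by simpa using hne')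
      have hj1 : 3 * j ^ 2 ≤ 4 := by nlinarith [sq_nonneg (2 * i + j)]
      have hi1 : 3 * i ^ 2 ≤ 4 := by nlinarith [sq_nonneg (2 * j + i)]
      have hj2 : -1 ≤ j := by nlinarith
      have hj3 : j ≤ 1 := by nlinarith
      have hi2 : -1 ≤ i := by nlinarith
      have hi3 : i ≤ 1 := by nlinarith
      interval_cases i <;> interval_cases j
      · norm_num at hQ'
      · exact ⟨1, by rw [slotH_eq_laPt]; exact congrArg _ (by decide)⟩  -- (-1,0)
      · exact ⟨5, by rw [slotH_eq_laPt]; exact congrArg _ (by decide)⟩  -- (-1,1)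
      · exact ⟨3, by rw [slotH_eq_laPt]; exact congrArg _ (by decide)⟩  -- (0,-1)
      · norm_num at hQ1
      · exact ⟨2, by rw [slotH_eq_laPt]; exact congrArg _ (by decide)⟩  -- (0,1)
      · exact ⟨4, by rw [slotH_eq_laPt]; exact congrArg _ (by decide)⟩  -- (1,-1)
      · exact ⟨0, by rw [slotH_eq_laPt]; exact congrArg _ (by decide)⟩  -- (1,0)
      · norm_num at hQ'
    · -- k = 1, label 1
      have hL : haggLabel alternatingHagg 1 = 1 := by rw [haggLabel_alternating]; decide
      rw [hL] at hsq hne ⊢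
      simp only [laHt] at hsq
      norm_num at hsq
      have hQ : (i : ℝ) ^ 2 + i * j + j ^ 2 + i + j < 71 / 100 := by nlinarith
      have hQ' : i ^ 2 + i * j + j ^ 2 + i + j ≤ 0 := by
        have : ((i ^ 2 + i * j + j ^ 2 + i + j : ℤ) : ℝ) < 1 := by push_cast; linarith
        have : i ^ 2 + i * j + j ^ 2 + i + j < 1 := by exact_mod_cast this
        omega
      have hj1 : 3 * j ^ 2 + 2 * j - 1 ≤ 0 := by nlinarith [sq_nonneg (2 * i + j + 1)]
      have hi1 : 3 * i ^ 2 + 2 * i - 1 ≤ 0 := by nlinarith [sq_nonneg (2 * j + i + 1)]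
      have hj2 : -1 ≤ j := by nlinarith
      have hj3 : j ≤ 0 := by nlinarith
      have hi2 : -1 ≤ i := by nlinarith
      have hi3 : i ≤ 0 := by nlinarith
      interval_cases i <;> interval_cases j
      · norm_num at hQ'
      · exact ⟨7, by rw [slotH_eq_laPt]; exact congrArg _ (by decide)⟩
      · exact ⟨8, by rw [slotH_eq_laPt]; exact congrArg _ (by decide)⟩
      · exact ⟨6, by rw [slotH_eq_laPt]; exact congrArg _ (by decide)⟩
  · rintro ⟨m, rfl⟩
    obtain ⟨hk, hcode⟩ := hcpIdx_spec m
    have hLab : haggLabel alternatingHagg (hcpIdx m).1 = (if (hcpIdx m).1 = 0 then 0 else 1) := by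
      rcases hk with h | h | h <;> rw [h, haggLabel_alternating] <;> decide
    refine ⟨⟨(hcpIdx m).1, (hcpIdx m).2.1, (hcpIdx m).2.2, ?_⟩, ?_, ?_⟩
    · rw [barlowPos_eq_laPt _ _ _ hk, slotH_eq_laPt, hcode, hLab]
    · intro h0
      have hn := la_norm_code (kp := h₀) (km := h₀) ha0 false m
      simp only [laCode, Bool.false_eq_true, ↓reduceIte] at hn
      rw [← slotH_eq_laPt, h0, norm_zero] at hn
      rcases hn with ⟨-, hn⟩ | ⟨-, hn⟩ | ⟨-, hn⟩ <;> nlinarith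
    · have hn := la_norm_code (kp := h₀) (km := h₀) ha0 false m
      simp only [laCode, Bool.false_eq_true, ↓reduceIte] at hn
      rw [← slotH_eq_laPt] at hn
      have hlt : ‖slotH a₀ h₀ h₀ m‖ ^ 2 < (13 / 10 * a₀) ^ 2 := by
        rcases hn with ⟨-, hn⟩ | ⟨-, hn⟩ | ⟨-, hn⟩
        · rw [hn]; nlinarith
        · rw [hn]; nlinarith
        · rw [hn]; nlinarith
      exact lt_of_pow_lt_pow_left₀ 2 (by positivity) hlt

/-- Layer/in-plane indices `(k, i, j)` of the twelve fcc slots. [folklore] -/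
def fccIdx : Fin 12 → ℤ × ℤ × ℤ :=
  ![(0, 1, 0), (0, -1, 0), (0, 0, 1), (0, 0, -1), (0, 1, -1), (0, -1, 1),
    (1, 0, 0), (1, -1, 0), (1, 0, -1), (-1, 0, 0), (-1, 1, 0), (-1, 0, 1)]

/-- The fcc slot indices have layer `k ∈ {-1, 0, 1}` and match the integer atlas `laCodeC`. [folklore] -/
theorem fccIdx_spec (m : Fin 12) : ((fccIdx m).1 = -1 ∨ (fccIdx m).1 = 0 ∨ (fccIdx m).1 = 1) ∧
    laCodeC m = (3 * (fccIdx m).2.1 + (fccIdx m).1, 3 * (fccIdx m).2.2 + (fccIdx m).1, (fccIdx m).1) := by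
  revert m; decide

/-- **Dictionary, fcc.** On the box the punctured open `1.3a₀`-shell of the origin in `fccStacking a₀ h₀` IS `range (slotC a₀ h₀ h₀)` (staggered triangles: labels `±1`). [folklore] -/
theorem templateShell_fcc_eq_range_slotC {a₀ h₀ : ℝ} (hb : InBox a₀ h₀) :
    templateShell (fccStacking a₀ h₀) a₀ = Set.range (slotC a₀ h₀ h₀) := by
  obtain ⟨ha0, hlo, hhi⟩ := hb.bounds
  have hh0 : 0 < h₀ := by linarith
  ext p
  simp only [templateShell, Set.mem_setOf_eq, Set.mem_range, fccStacking, barlowStacking]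
  constructor
  · rintro ⟨⟨k, i, j, rfl⟩, hne, hnorm⟩
    have hz := abs_mul_le_norm_barlowPos a₀ h₀ constHagg k i j
    have h1 : |(k : ℝ)| * h₀ < 13 / 10 * a₀ := by
      rw [abs_mul, abs_of_pos hh0] at hz
      exact hz.trans_lt hnorm
    have h2 : |(k : ℝ)| < 2 := by
      nlinarith [mul_nonneg (abs_nonneg (k : ℝ)) (sub_nonneg.2 hlo), abs_nonneg (k : ℝ)]
    have h3 : |k| < 2 := by exact_mod_cast h2
    have hk : k = -1 ∨ k = 0 ∨ k = 1 := by
      rcases abs_lt.1 h3 with ⟨h4, h5⟩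
      omega
    have hsq : ‖barlowPos a₀ h₀ constHagg k i j‖ ^ 2 < (13 / 10 * a₀) ^ 2 :=
      pow_lt_pow_left₀ hnorm (norm_nonneg _) two_ne_zero
    rw [barlowPos_eq_laPt a₀ h₀ constHagg hk] at hsq hne ⊢
    rw [norm_laPt_sq] at hsq
    simp only [haggLabel_const] at hsq hne ⊢
    rcases hk with rfl | rfl | rfl
    · -- k = -1, label -1
      simp only [laHt] at hsq
      norm_num at hsq
      have hQ : (i : ℝ) ^ 2 + i * j + j ^ 2 - i - j < 71 / 100 := by nlinarith
      have hQ' : i ^ 2 + i * j + j ^ 2 - i - j ≤ 0 := by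
        have : ((i ^ 2 + i * j + j ^ 2 - i - j : ℤ) : ℝ) < 1 := by push_cast; linarith
        have : i ^ 2 + i * j + j ^ 2 - i - j < 1 := by exact_mod_cast this
        omega
      have hj1 : 3 * j ^ 2 - 2 * j - 1 ≤ 0 := by nlinarith [sq_nonneg (2 * i + j - 1)]
      have hi1 : 3 * i ^ 2 - 2 * i - 1 ≤ 0 := by nlinarith [sq_nonneg (2 * j + i - 1)]
      have hj2 : 0 ≤ j := by nlinarith
      have hj3 : j ≤ 1 := by nlinarith
      have hi2 : 0 ≤ i := by nlinarith
      have hi3 : i ≤ 1 := by nlinarith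
      interval_cases i <;> interval_cases j
      · exact ⟨9, by rw [slotC_eq_laPt]; exact congrArg _ (by decide)⟩
      · exact ⟨11, by rw [slotC_eq_laPt]; exact congrArg _ (by decide)⟩
      · exact ⟨10, by rw [slotC_eq_laPt]; exact congrArg _ (by decide)⟩
      · norm_num at hQ'
    · -- k = 0, label 0
      simp only [laHt] at hsq
      norm_num at hsq
      have hQ : (i : ℝ) ^ 2 + i * j + j ^ 2 < 169 / 100 := by nlinarith
      have hQ' : i ^ 2 + i * j + j ^ 2 ≤ 1 := by
        have : ((i ^ 2 + i * j + j ^ 2 : ℤ) : ℝ) < 2 := by push_cast; linarith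
        have : i ^ 2 + i * j + j ^ 2 < 2 := by exact_mod_cast this
        omega
      have hne' : (i, j) ≠ (0, 0) := by
        rintro ⟨⟩
        apply hne
        simp [laPt, laHt]
      have hQ1 : 1 ≤ i ^ 2 + i * j + j ^ 2 := one_le_sq_add_mul_add_sq (by simpa using hne')
      have hj1 : 3 * j ^ 2 ≤ 4 := by nlinarith [sq_nonneg (2 * i + j)]
      have hi1 : 3 * i ^ 2 ≤ 4 := by nlinarith [sq_nonneg (2 * j + i)]
      have hj2 : -1 ≤ j := by nlinarith
      have hj3 : j ≤ 1 := by nlinarith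
      have hi2 : -1 ≤ i := by nlinarith
      have hi3 : i ≤ 1 := by nlinarith
      interval_cases i <;> interval_cases j
      · norm_num at hQ'
      · exact ⟨1, by rw [slotC_eq_laPt]; exact congrArg _ (by decide)⟩
      · exact ⟨5, by rw [slotC_eq_laPt]; exact congrArg _ (by decide)⟩
      · exact ⟨3, by rw [slotC_eq_laPt]; exact congrArg _ (by decide)⟩
      · norm_num at hQ1
      · exact ⟨2, by rw [slotC_eq_laPt]; exact congrArg _ (by decide)⟩
      · exact ⟨4, by rw [slotC_eq_laPt]; exact congrArg _ (by decide)⟩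
      · exact ⟨0, by rw [slotC_eq_laPt]; exact congrArg _ (by decide)⟩
      · norm_num at hQ'
    · -- k = 1, label 1
      simp only [laHt] at hsq
      norm_num at hsq
      have hQ : (i : ℝ) ^ 2 + i * j + j ^ 2 + i + j < 71 / 100 := by nlinarith
      have hQ' : i ^ 2 + i * j + j ^ 2 + i + j ≤ 0 := by
        have : ((i ^ 2 + i * j + j ^ 2 + i + j : ℤ) : ℝ) < 1 := by push_cast; linarith
        have : i ^ 2 + i * j + j ^ 2 + i + j < 1 := by exact_mod_cast this
        omega
      have hj1 : 3 * j ^ 2 + 2 * j - 1 ≤ 0 := by nlinarith [sq_nonneg (2 * i + j + 1)]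
      have hi1 : 3 * i ^ 2 + 2 * i - 1 ≤ 0 := by nlinarith [sq_nonneg (2 * j + i + 1)]
      have hj2 : -1 ≤ j := by nlinarith
      have hj3 : j ≤ 0 := by nlinarith
      have hi2 : -1 ≤ i := by nlinarith
      have hi3 : i ≤ 0 := by nlinarith
      interval_cases i <;> interval_cases j
      · norm_num at hQ'
      · exact ⟨7, by rw [slotC_eq_laPt]; exact congrArg _ (by decide)⟩
      · exact ⟨8, by rw [slotC_eq_laPt]; exact congrArg _ (by decide)⟩
      · exact ⟨6, by rw [slotC_eq_laPt]; exact congrArg _ (by decide)⟩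
  · rintro ⟨m, rfl⟩
    obtain ⟨hk, hcode⟩ := fccIdx_spec m
    refine ⟨⟨(fccIdx m).1, (fccIdx m).2.1, (fccIdx m).2.2, ?_⟩, ?_, ?_⟩
    · rw [barlowPos_eq_laPt _ _ _ hk, slotC_eq_laPt, hcode, haggLabel_const]
    · intro h0
      have hn := la_norm_code (kp := h₀) (km := h₀) ha0 true m
      simp only [laCode, ↓reduceIte] at hn
      rw [← slotC_eq_laPt, h0, norm_zero] at hn
      rcases hn with ⟨-, hn⟩ | ⟨-, hn⟩ | ⟨-, hn⟩ <;> nlinarith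
    · have hn := la_norm_code (kp := h₀) (km := h₀) ha0 true m
      simp only [laCode, ↓reduceIte] at hn
      rw [← slotC_eq_laPt] at hn
      have hlt : ‖slotC a₀ h₀ h₀ m‖ ^ 2 < (13 / 10 * a₀) ^ 2 := by
        rcases hn with ⟨-, hn⟩ | ⟨-, hn⟩ | ⟨-, hn⟩
        · rw [hn]; nlinarith
        · rw [hn]; nlinarith
        · rw [hn]; nlinarith
      exact lt_of_pow_lt_pow_left₀ 2 (by positivity) hlt


/-- Radial band of the slots on the box: every slot of either model has norm in `[0.98a₀, 1.02a₀]`. [folklore] -/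
theorem laSlot_norm_band {a₀ h₀ : ℝ} (hb : InBox a₀ h₀) (t : Bool) (k : Fin 12) :
    a₀ * (1 - 1 / 50) ≤ ‖laSlot t a₀ h₀ h₀ k‖ ∧ ‖laSlot t a₀ h₀ h₀ k‖ ≤ a₀ * (1 + 1 / 50) := by
  obtain ⟨ha0, hlo, hhi⟩ := hb.bounds
  have hn := la_norm_code (kp := h₀) (km := h₀) ha0 t k
  rw [← laSlot_eq_laPt] at hn
  have h0 : 0 ≤ ‖laSlot t a₀ h₀ h₀ k‖ := norm_nonneg _
  rcases hn with ⟨-, hn⟩ | ⟨-, hn⟩ | ⟨-, hn⟩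
  · rw [hn]; constructor <;> nlinarith
  · constructor
    · exact (pow_le_pow_iff_left₀ (by nlinarith) h0 two_ne_zero).1 (by rw [hn]; nlinarith)
    · exact (pow_le_pow_iff_left₀ h0 (by nlinarith) two_ne_zero).1 (by rw [hn]; nlinarith)
  · constructor
    · exact (pow_le_pow_iff_left₀ (by nlinarith) h0 two_ne_zero).1 (by rw [hn]; nlinarith)
    · exact (pow_le_pow_iff_left₀ h0 (by nlinarith) two_ne_zero).1 (by rw [hn]; nlinarith)

/-- An exact shell, read through the dictionary: the punctured open `1.3a₀`-shell of `p` is the rotated slot model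
of one of the two types, translated to `p`. [folklore] -/
theorem exactShell_iff_laSlot {a₀ h₀ : ℝ} (hb : InBox a₀ h₀) {Z : Set E3} {p : E3} :
    ExactShell a₀ h₀ Z p ↔ ∃ (A : E3 →ₗᵢ[ℝ] E3) (t : Bool),
      shellIn Z p a₀ = Set.range fun k : Fin 12 => p + A (laSlot t a₀ h₀ h₀ k) := by
  unfold ExactShell
  rw [templateShell_hcp_eq_range_slotH hb, templateShell_fcc_eq_range_slotC hb]
  constructor
  · rintro ⟨A, h | h⟩
    · exact ⟨A, false, by rw [h, ← Set.range_comp]; rfl⟩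
    · exact ⟨A, true, by rw [h, ← Set.range_comp]; rfl⟩
  · rintro ⟨A, t, h⟩
    cases t
    · exact ⟨A, Or.inl (by rw [h, ← Set.range_comp]; rfl)⟩
    · exact ⟨A, Or.inr (by rw [h, ← Set.range_comp]; rfl)⟩

/-- **Dictionary into the landed chain (PROVED).** Exact template shells everywhere give, at scale `a := a₀`, the
gap clause `hgap` and the exact-slot clause `hexact` of `CleanHull.stub_firstLayer / stub_layerStepUp /
stub_layeredOfExactShells` (radial band `[0.98a₀, 1.02a₀]` from `laSlot_norm_band`; gap: nothing else below
`1.3a₀ ≥ 1.26a₀`). [folklore] -/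
theorem cleanHull_hyps_of_exactShell {a₀ h₀ : ℝ} (hb : InBox a₀ h₀) {Z : Set E3}
    (hZ : ∀ p ∈ Z, ExactShell a₀ h₀ Z p) :
    (∀ y ∈ Z, ∀ w ∈ Z, w ≠ y → a₀ * (1 - 1 / 50) ≤ dist y w ∧
      (dist y w ≤ a₀ * (1 + 1 / 50) ∨ a₀ * (63 / 50) ≤ dist y w)) ∧
    (∀ p ∈ Z, ∃ (a' hp' hm' : ℝ) (A : E3 →ₗᵢ[ℝ] E3), 0 < a' ∧ 0 < hp' ∧ 0 < hm' ∧
      ((bondShell a₀ Z p = Set.range fun k : Fin 12 => p + A (slotC a' hp' hm' k)) ∨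
       (bondShell a₀ Z p = Set.range fun k : Fin 12 => p + A (slotH a' hp' hm' k)))) := by
  obtain ⟨ha0, hlo, hhi⟩ := hb.bounds
  have hh0 : 0 < h₀ := by linarith
  -- distances from a site to the points of its shell
  have hshell : ∀ p ∈ Z, ∃ (A : E3 →ₗᵢ[ℝ] E3) (t : Bool),
      shellIn Z p a₀ = Set.range (fun k : Fin 12 => p + A (laSlot t a₀ h₀ h₀ k)) :=
    fun p hp => (exactShell_iff_laSlot hb).1 (hZ p hp)
  have hband : ∀ p ∈ Z, ∀ w ∈ shellIn Z p a₀,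
      a₀ * (1 - 1 / 50) ≤ dist p w ∧ dist p w ≤ a₀ * (1 + 1 / 50) := by
    intro p hp w hw
    obtain ⟨A, t, hA⟩ := hshell p hp
    rw [hA] at hw
    obtain ⟨k, rfl⟩ := hw
    have : dist p (p + A (laSlot t a₀ h₀ h₀ k)) = ‖laSlot t a₀ h₀ h₀ k‖ := by
      rw [dist_eq_norm]; simp
    rw [this]
    exact laSlot_norm_band hb t k
  refine ⟨fun y hy w hw hwy => ?_, fun p hp => ?_⟩
  · by_cases hd : dist w y < 13 / 10 * a₀
    · have hw' : w ∈ shellIn Z y a₀ := ⟨hw, hwy, hd⟩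
      obtain ⟨h1, h2⟩ := hband y hy w hw'
      exact ⟨h1, Or.inl h2⟩
    · push Not at hd
      rw [dist_comm] at hd
      constructor
      · nlinarith
      · exact Or.inr (by nlinarith)
  · obtain ⟨A, t, hA⟩ := hshell p hp
    have hbond : bondShell a₀ Z p = Set.range (fun k : Fin 12 => p + A (laSlot t a₀ h₀ h₀ k)) := by
      rw [← hA]
      ext w
      simp only [bondShell, shellIn, Set.mem_setOf_eq]
      constructor
      · rintro ⟨hw, hwp, hd⟩
        refine ⟨hw, hwp, ?_⟩
        rw [dist_comm]; nlinarith
      · rintro ⟨hw, hwp, hd⟩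
        refine ⟨hw, hwp, ?_⟩
        exact (hband p hp w ⟨hw, hwp, hd⟩).2
    refine ⟨a₀, h₀, h₀, A, ha0, hh0, hh0, ?_⟩
    cases t
    · exact Or.inr (by rw [hbond]; rfl)
    · exact Or.inl (by rw [hbond]; rfl)


/-! ## S1 proved: shell congruence (two letters) passes to local limits -/

/-- The template shells are finite (twelve slots, by the dictionary). [folklore] -/
theorem templateShell_finite {a₀ h₀ : ℝ} (hb : InBox a₀ h₀) :
    (templateShell (hcpStacking a₀ h₀) a₀).Finite ∧ (templateShell (fccStacking a₀ h₀) a₀).Finite := by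
  rw [templateShell_hcp_eq_range_slotH hb, templateShell_fcc_eq_range_slotC hb]
  exact ⟨Set.finite_range _, Set.finite_range _⟩

/-- **S1 (proof of the registered stub `stub_goodOfLimit`, readable form).** If `Y_k → Y` locally, all sets are
`δ`-separated, the points of `Y_k` of norm `≤ ρ_k → ∞` are `τ_k`-good with `τ_k → 0`, then every point of `Y` is
`η`-good for every `η > 0` — the two-letter twin of `HullExactShells.good_of_limit` (the conclusion inherits the letter
of a partner of the point in a good index). [folklore] -/
theorem goodOfLimit_proof (a₀ h₀ δ : ℝ) (ha : 47 / 50 ≤ a₀) (ha' : a₀ ≤ 1)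
    (hh : |h₀ - a₀ * Real.sqrt (2 / 3)| ≤ a₀ / 100) (hδ : 0 < δ)
    (Ys : ℕ → Set E3) (Y : Set E3) (τ ρ : ℕ → ℝ)
    (hsep : ∀ k : ℕ, ∀ p ∈ Ys k, ∀ q ∈ Ys k, p ≠ q → δ ≤ dist p q)
    (hYsep : ∀ p ∈ Y, ∀ q ∈ Y, p ≠ q → δ ≤ dist p q)
    (hgood : ∀ k : ℕ, ∀ q ∈ Ys k, ‖q‖ ≤ ρ k → GoodIn a₀ h₀ (τ k) (Ys k) q)
    (hτ : Tendsto τ atTop (𝓝 0)) (hρ : Tendsto ρ atTop atTop)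
    (hlim : ∀ R ε : ℝ, 0 < ε → ∀ᶠ k : ℕ in atTop, BallMatch ε R 0 (Ys k) Y) :
    ∀ p ∈ Y, ∀ η : ℝ, 0 < η → GoodIn a₀ h₀ η Y p := by
  classical
  intro p hp η hη
  have hb : InBox a₀ h₀ := ⟨ha, ha', hh⟩
  obtain ⟨ha0, -, -⟩ := hb.bounds
  set r : ℝ := 13 / 10 * a₀ with hr_def
  have hr : 0 < r := by positivity
  -- (1) margins: both template shells stay `m` inside the open cutoff, the limit shell `mT`
  obtain ⟨hfinH, hfinF⟩ := templateShell_finite hb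
  obtain ⟨mH, hmH0, hmH⟩ := Summit.AtomisticToContinuum.Crystallization.Theorems.HullExactShells.exists_margin_norm
    hfinH hr (fun q hq => hq.2.2)
  obtain ⟨mF, hmF0, hmF⟩ := Summit.AtomisticToContinuum.Crystallization.Theorems.HullExactShells.exists_margin_norm
    hfinF hr (fun q hq => hq.2.2)
  set m : ℝ := min mH mF with hm_def
  have hm0 : 0 < m := lt_min hmH0 hmF0
  have hmH' : ∀ q ∈ templateShell (hcpStacking a₀ h₀) a₀, ‖q‖ + m ≤ r :=
    fun q hq => by linarith [hmH q hq, min_le_left mH mF]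
  have hmF' : ∀ q ∈ templateShell (fccStacking a₀ h₀) a₀, ‖q‖ + m ≤ r :=
    fun q hq => by linarith [hmF q hq, min_le_right mH mF]
  have hTfin : (shellIn Y p a₀).Finite :=
    finite_of_forall_le_dist_of_subset_closedBall hδ
      (fun x hx y hy hxy => hYsep x hx.1 y hy.1 hxy) (c := p) (R := r)
      fun w hw => Metric.mem_closedBall.2 hw.2.2.le
  obtain ⟨mT, hmT0, hmT⟩ := Summit.AtomisticToContinuum.Crystallization.Theorems.HullExactShells.exists_margin_dist
    hTfin hr (fun t ht => ht.2.2)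
  -- (2) tolerances
  obtain ⟨η₁, hη₁0, hη₁η, hη₁m, -, -, -⟩ :=
    Summit.AtomisticToContinuum.Crystallization.Theorems.HullExactShells.exists_pos_le_five
      (a := η / 2) (b := m / 2) (c := 1) (d := 1) (e := 1)
      (by positivity) (by positivity) one_pos one_pos one_pos
  obtain ⟨ε, hε0, hεδ, hεT, hεm, hεη, hε1⟩ :=
    Summit.AtomisticToContinuum.Crystallization.Theorems.HullExactShells.exists_pos_le_five
      (a := δ / 4) (b := mT / 4) (c := m / 8) (d := η / 8) (e := 1)
      (by positivity) (by positivity) (by positivity) (by positivity) one_pos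
  have h2ε : 2 * ε < δ := by linarith
  -- (3) a good index: matched at radius `‖p‖ + r + 1`, tolerance `τ k ≤ η₁`, radius `ρ k ≥ ‖p‖ + 1`
  have hevτ : ∀ᶠ k : ℕ in atTop, τ k ≤ η₁ :=
    (Metric.tendsto_nhds.1 hτ η₁ hη₁0).mono fun k hk => by
      rw [Real.dist_eq, sub_zero] at hk
      exact (le_abs_self _).trans hk.le
  have hevρ : ∀ᶠ k : ℕ in atTop, ‖p‖ + 1 ≤ ρ k := Filter.tendsto_atTop.1 hρ _
  obtain ⟨k, hkM, hkτ, hkρ⟩ := ((hlim (‖p‖ + r + 1) ε hε0).and (hevτ.and hevρ)).exists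
  -- the partner `y'` of `p` and its goodness (letter of `y'`)
  obtain ⟨y', hy', hy'p⟩ := hkM.1 p hp (by rw [dist_zero_right]; linarith)
  have hy'n : ‖y'‖ ≤ ρ k := by
    have := Summit.AtomisticToContinuum.Crystallization.Theorems.HullExactShells.norm_le_norm_add_dist y' p
    linarith
  obtain ⟨A, hA⟩ := hgood k y' hy' hy'n
  -- shells stay `2ε` inside the cutoff
  have hTd : ∀ t ∈ Y, t ≠ p → dist t p < r → dist t p + 2 * ε < r := by
    intro t htY htp htr
    linarith [hmT t ⟨htY, htp, htr⟩]
  have hT'd : ∀ (B : Set E3), (∀ q ∈ templateShell B a₀, ‖q‖ + m ≤ r) →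
      MatchedWith (Ys k) y' a₀ (τ k) B A →
      ∀ t' ∈ Ys k, t' ≠ y' → dist t' y' < r → dist t' y' + 2 * ε < r := by
    intro B hBm hmatch t' ht'X ht'y ht'r
    obtain ⟨e', he'⟩ := hmatch
    have h1 := he' ⟨t', ht'X, ht'y, ht'r⟩
    have h2 := hBm _ (e' ⟨t', ht'X, ht'y, ht'r⟩).2
    have h4 : ‖t' - y'‖ ≤ ‖A ((e' ⟨t', ht'X, ht'y, ht'r⟩ : ↥(templateShell B a₀)) : E3)‖ +
        ‖t' - y' - A ((e' ⟨t', ht'X, ht'y, ht'r⟩ : ↥(templateShell B a₀)) : E3)‖ := by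
      linarith [norm_sub_norm_le (t' - y') (A ((e' ⟨t', ht'X, ht'y, ht'r⟩ : ↥(templateShell B a₀)) : E3))]
    rw [A.norm_map, ← dist_eq_norm, ← dist_eq_norm] at h4
    linarith
  -- (4) transport along the matching bijection, letter by letter
  rcases hA with hH | hF
  · have hT'dH := hT'd _ hmH' hH
    obtain ⟨b, hbb⟩ := Summit.AtomisticToContinuum.Crystallization.Theorems.HullExactShells.exists_matching_equiv
      hYsep (hsep k) h2ε hε1 hkM hp hy' hy'p hTd hT'dH
    obtain ⟨e', he'⟩ := hH
    obtain ⟨A', e, he⟩ := Summit.AtomisticToContinuum.Crystallization.Theorems.HullExactShells.good_transfer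
      (θ := 2 * ε) (η := η₁) (η' := η) b hbb ⟨A, e', fun t' => (he' t').trans hkτ⟩ (by linarith)
    exact ⟨A', Or.inl ⟨e, he⟩⟩
  · have hT'dF := hT'd _ hmF' hF
    obtain ⟨b, hbb⟩ := Summit.AtomisticToContinuum.Crystallization.Theorems.HullExactShells.exists_matching_equiv
      hYsep (hsep k) h2ε hε1 hkM hp hy' hy'p hTd hT'dF
    obtain ⟨e', he'⟩ := hF
    obtain ⟨A', e, he⟩ := Summit.AtomisticToContinuum.Crystallization.Theorems.HullExactShells.good_transfer
      (θ := 2 * ε) (η := η₁) (η' := η) b hbb ⟨A, e', fun t' => (he' t').trans hkτ⟩ (by linarith)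
    exact ⟨A', Or.inr ⟨e, he⟩⟩

/-- S1 in the registered (fully inlined) signature. [folklore] -/
theorem goodOfLimit_inlined : ∀ (a₀ h₀ δ : ℝ), 47 / 50 ≤ a₀ → a₀ ≤ 1 → |h₀ - a₀ * Real.sqrt (2 / 3)| ≤ a₀ / 100 → 0 < δ → ∀ (Ys : ℕ → Set (EuclideanSpace ℝ (Fin 3))) (Y : Set (EuclideanSpace ℝ (Fin 3))) (τ ρ : ℕ → ℝ), (∀ k : ℕ, ∀ p ∈ Ys k, ∀ q ∈ Ys k, p ≠ q → δ ≤ dist p q) → (∀ p ∈ Y, ∀ q ∈ Y, p ≠ q → δ ≤ dist p q) → (∀ k : ℕ, ∀ q ∈ Ys k, ‖q‖ ≤ ρ k → (∃ A : EuclideanSpace ℝ (Fin 3) →ₗᵢ[ℝ] EuclideanSpace ℝ (Fin 3), (∃ e : ↥{z : EuclideanSpace ℝ (Fin 3) | z ∈ Ys k ∧ z ≠ q ∧ dist z q < 13 / 10 * a₀} ≃ ↥{q : EuclideanSpace ℝ (Fin 3) | q ∈ Literature.MathematicalPhysics.StatisticalMechanics.hcpStacking a₀ h₀ ∧ q ≠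 0 ∧ ‖q‖ < 13 / 10 * a₀}, ∀ t : ↥{z : EuclideanSpace ℝ (Fin 3) | z ∈ Ys k ∧ z ≠ q ∧ dist z q < 13 / 10 * a₀}, dist ((t : EuclideanSpace ℝ (Fin 3)) - q) (A ((e t : ↥{q : EuclideanSpace ℝ (Fin 3) | q ∈ Literature.MathematicalPhysics.StatisticalMechanics.hcpStacking a₀ h₀ ∧ q ≠ 0 ∧ ‖q‖ < 13 / 10 * a₀}) : EuclideanSpace ℝ (Fin 3))) ≤ τ k) ∨ (∃ e : ↥{z : EuclideanSpace ℝ (Fin 3) | z ∈ Ys k ∧ z ≠ q ∧ dist z q < 13 / 10 * a₀} ≃ ↥{q : EuclideanSpace ℝ (Fin 3) | q ∈ Literature.MathematicalPhysics.StatisticalMechanics.fccStacking a₀ h₀ ∧ q ≠ 0 ∧ ‖q‖ < 13 / 10 * a₀}, ∀ t : ↥{z : EuclideanSpace ℝ (Fin 3) | z ∈ Ys k ∧ z ≠ q ∧ dist z q < 13 / 10 * a₀}, dist ((t : EuclideanSpace ℝ (Fin 3)) - q) (A ((e t : ↥{q : EuclideanSpace ℝ (Fin 3) | q ∈ Literature.MathematicalPhysics.StatisticalMechanics.fccStacking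 a₀ h₀ ∧ q ≠ 0 ∧ ‖q‖ < 13 / 10 * a₀}) : EuclideanSpace ℝ (Fin 3))) ≤ τ k))) → Filter.Tendsto τ Filter.atTop (nhds 0) → Filter.Tendsto ρ Filter.atTop Filter.atTop → (∀ R ε : ℝ, 0 < ε → ∀ᶠ k : ℕ in Filter.atTop, Literature.MathematicalPhysics.StatisticalMechanics.BallMatch ε R 0 (Ys k) Y) → ∀ p ∈ Y, ∀ η : ℝ, 0 < η → (∃ A : EuclideanSpace ℝ (Fin 3) →ₗᵢ[ℝ] EuclideanSpace ℝ (Fin 3), (∃ e : ↥{z : EuclideanSpace ℝ (Fin 3) | z ∈ Y ∧ z ≠ p ∧ dist z p < 13 / 10 * a₀} ≃ ↥{q : EuclideanSpace ℝ (Fin 3) | q ∈ Literature.MathematicalPhysics.StatisticalMechanics.hcpStacking a₀ h₀ ∧ q ≠ 0 ∧ ‖q‖ < 13 / 10 * a₀}, ∀ t : ↥{z : EuclideanSpace ℝ (Fin 3) | z ∈ Y ∧ z ≠ p ∧ dist z p < 13 / 10 * a₀}, dist ((t : EuclideanSpace ℝ (Fin 3)) - p) (A ((e t : ↥{q : EuclideanSpace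 ℝ (Fin 3) | q ∈ Literature.MathematicalPhysics.StatisticalMechanics.hcpStacking a₀ h₀ ∧ q ≠ 0 ∧ ‖q‖ < 13 / 10 * a₀}) : EuclideanSpace ℝ (Fin 3))) ≤ η) ∨ (∃ e : ↥{z : EuclideanSpace ℝ (Fin 3) | z ∈ Y ∧ z ≠ p ∧ dist z p < 13 / 10 * a₀} ≃ ↥{q : EuclideanSpace ℝ (Fin 3) | q ∈ Literature.MathematicalPhysics.StatisticalMechanics.fccStacking a₀ h₀ ∧ q ≠ 0 ∧ ‖q‖ < 13 / 10 * a₀}, ∀ t : ↥{z : EuclideanSpace ℝ (Fin 3) | z ∈ Y ∧ z ≠ p ∧ dist z p < 13 / 10 * a₀}, dist ((t : EuclideanSpace ℝ (Fin 3)) - p) (A ((e t : ↥{q : EuclideanSpace ℝ (Fin 3) | q ∈ Literature.MathematicalPhysics.StatisticalMechanics.fccStacking a₀ h₀ ∧ q ≠ 0 ∧ ‖q‖ < 13 / 10 * a₀}) : EuclideanSpace ℝ (Fin 3))) ≤ η)) :=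
  goodOfLimit_proof

/-! ## S2 proved: exactification (`∀ η > 0` good ⇒ exact template shell), both letters -/

section Exactify

open RealInnerProductSpace

/-- **A linear isometry from Gram data on a frame** (pattern-generic form of
`ExactHcpLocal.exists_isometry_of_gram`): a map `φ` preserving inner products on a set `P` that contains a
linearly independent triple agrees on `P` with a linear isometry equivalence of `ℝ³`. [folklore] -/
theorem exists_isometry_of_gram_frame {P : Set E3} (f : Fin 3 → E3) (hf : LinearIndependent ℝ f)
    (hfP : ∀ i, f i ∈ P) (φ : E3 → E3) (hφ : ∀ p ∈ P, ∀ q ∈ P, ⟪φ p, φ q⟫ = ⟪p, q⟫) :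
    ∃ B : E3 ≃ₗᵢ[ℝ] E3, ∀ p ∈ P, B p = φ p := by
  let b : Module.Basis (Fin 3) ℝ E3 := basisOfLinearIndependentOfCardEqFinrank hf (by simp)
  have hb : ⇑b = f := coe_basisOfLinearIndependentOfCardEqFinrank _ _
  set L : E3 →ₗ[ℝ] E3 := b.constr ℝ fun i => φ (f i) with hL
  have hLb : ∀ i, L (b i) = φ (f i) := fun i => by rw [hL, Module.Basis.constr_basis]
  have hLq : ∀ x, ∀ q ∈ P, ⟪L x, φ q⟫ = ⟪x, q⟫ := by
    intro x q hq
    conv_lhs => rw [← b.sum_repr x]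
    conv_rhs => rw [← b.sum_repr x]
    simp only [map_sum, map_smul, sum_inner, inner_smul_left, hLb]
    refine Finset.sum_congr rfl fun i _ => ?_
    rw [hφ _ (hfP i) _ hq, hb]
  have hLL : ∀ x x', ⟪L x, L x'⟫ = ⟪x, x'⟫ := by
    intro x x'
    conv_lhs => rw [← b.sum_repr x']
    conv_rhs => rw [← b.sum_repr x']
    simp only [map_sum, map_smul, inner_sum, inner_smul_right, hLb]
    refine Finset.sum_congr rfl fun i _ => ?_
    rw [hLq x _ (hfP i), hb]
  set B₀ := L.isometryOfInner hLL with hB₀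
  refine ⟨B₀.toLinearIsometryEquiv rfl, fun p hp => ?_⟩
  rw [LinearIsometry.toLinearIsometryEquiv_apply, hB₀, LinearMap.coe_isometryOfInner]
  have h0 : ⟪L p - φ p, L p - φ p⟫ = 0 := by
    rw [inner_sub_left, inner_sub_right, inner_sub_right, hLL, hLq p p hp, real_inner_comm (L p) (φ p),
      hLq p p hp, hφ p hp p hp]
    ring
  rw [real_inner_self_eq_norm_sq] at h0
  have : ‖L p - φ p‖ = 0 := by nlinarith [norm_nonneg (L p - φ p)]
  exact sub_eq_zero.1 (norm_eq_zero.1 this)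

/-- **Exactification for a finite pattern containing a frame** (pattern-generic form of
`ExactHcpLocal.exact_cluster`, punctured statement): if `T` is `η`-congruent to `P` for every `η > 0`
(isometry + bijection), all points of `T` are within `r` of `y`, all points of `P` have norm `< r`, and `P`
contains a linearly independent triple, then `T = y + B(P)` for a linear isometry `B`. [folklore] -/
theorem shell_eq_image_of_forall_eta {T P : Set E3} (hPfin : P.Finite) {y : E3} {r : ℝ} (hr : 0 < r)
    (hTr : ∀ t ∈ T, dist t y < r) (hPr : ∀ q ∈ P, ‖q‖ < r)
    (f : Fin 3 → E3) (hf : LinearIndependent ℝ f) (hfP : ∀ i, f i ∈ P)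
    (hloc : ∀ η : ℝ, 0 < η → ∃ A : E3 →ₗᵢ[ℝ] E3, ∃ e : ↥T ≃ ↥P,
      ∀ t : ↥T, dist ((t : E3) - y) (A ((e t : ↥P) : E3)) ≤ η) :
    ∃ B : E3 →ₗᵢ[ℝ] E3, T = (fun q => y + B q) '' P := by
  classical
  haveI : Finite ↥P := hPfin.to_subtype
  obtain ⟨e, he⟩ := Summit.AtomisticToContinuum.Crystallization.Theorems.ExactHcpLocal.exists_equiv_forall_eta hloc
  have gram := Summit.AtomisticToContinuum.Crystallization.Theorems.ExactHcpLocal.inner_eq_of_forall_eta hr (T := T) (P := P) (y := y)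
    (fun t => by rw [← dist_eq_norm]; exact le_of_lt (hTr t t.2)) (fun p => le_of_lt (hPr p p.2)) e he
  set φ : E3 → E3 := fun p => if hp : p ∈ P then ((e.symm ⟨p, hp⟩ : ↥T) : E3) - y else 0 with hφdef
  have hφ : ∀ p (hp : p ∈ P), φ p = ((e.symm ⟨p, hp⟩ : ↥T) : E3) - y := by
    intro p hp; rw [hφdef]; simp only [dif_pos hp]
  have hφgram : ∀ p ∈ P, ∀ q ∈ P, ⟪φ p, φ q⟫ = ⟪p, q⟫ := by
    intro p hp q hq
    rw [hφ p hp, hφ q hq, gram]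
    simp
  obtain ⟨B, hB⟩ := exists_isometry_of_gram_frame f hf hfP φ hφgram
  refine ⟨B.toLinearIsometry, Set.Subset.antisymm ?_ ?_⟩
  · intro x hxT
    set q := e ⟨x, hxT⟩ with hq
    refine ⟨(q : E3), q.2, ?_⟩
    show y + B q = x
    rw [hB _ q.2, hφ _ q.2]
    have : e.symm ⟨(q : E3), q.2⟩ = ⟨x, hxT⟩ := by
      rw [Subtype.coe_eta, hq, e.symm_apply_apply]
    rw [this]; abel
  · rintro x ⟨n, hn, rfl⟩
    have e1 : y + B n = ((e.symm ⟨n, hn⟩ : ↥T) : E3) := by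
      rw [hB n hn, hφ n hn]; abel
    show y + B n ∈ T
    rw [e1]
    exact (e.symm ⟨n, hn⟩).2

end Exactify

/-- Matching is monotone in the tolerance. [folklore] -/
theorem matchedWith_mono {S : Set E3} {p : E3} {a₀ η η' : ℝ} {B : Set E3} {A : E3 →ₗᵢ[ℝ] E3}
    (h : MatchedWith S p a₀ η B A) (hle : η ≤ η') : MatchedWith S p a₀ η' B A := by
  obtain ⟨e, he⟩ := h
  exact ⟨e, fun t => (he t).trans hle⟩

/-- The frame `u, v, w + h₀e₃` lies in both template shells and is linearly independent on the box.
[folklore] -/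
theorem frame_mem_templateShell {a₀ h₀ : ℝ} (hb : InBox a₀ h₀) :
    LinearIndependent ℝ ![barlowPos a₀ h₀ alternatingHagg 0 1 0, barlowPos a₀ h₀ alternatingHagg 0 0 1,
        barlowPos a₀ h₀ alternatingHagg 1 0 0] ∧
    (∀ i : Fin 3, ![barlowPos a₀ h₀ alternatingHagg 0 1 0, barlowPos a₀ h₀ alternatingHagg 0 0 1,
        barlowPos a₀ h₀ alternatingHagg 1 0 0] i ∈ templateShell (hcpStacking a₀ h₀) a₀) ∧
    (∀ i : Fin 3, ![barlowPos a₀ h₀ alternatingHagg 0 1 0, barlowPos a₀ h₀ alternatingHagg 0 0 1,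
        barlowPos a₀ h₀ alternatingHagg 1 0 0] i ∈ templateShell (fccStacking a₀ h₀) a₀) := by
  obtain ⟨ha0, hlo, hhi⟩ := hb.bounds
  have hh0 : 0 < h₀ := by linarith
  have hh1 : 64 / 100 * a₀ ^ 2 < h₀ ^ 2 := by nlinarith
  have hh2 : h₀ ^ 2 < 69 / 100 * a₀ ^ 2 := by nlinarith
  have hL1 : haggLabel alternatingHagg 1 = 1 := haggLabel_alternating_of_odd odd_one
  -- the three hcp sites: non-zero, short
  have hne : ∀ k i j : ℤ, ¬ (k = 0 ∧ i = 0 ∧ j = 0) → barlowPos a₀ h₀ alternatingHagg k i j ≠ 0 := by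
    intro k i j hne h0
    rw [← barlowPos_alternating_zero a₀ h₀] at h0
    exact hne (Summit.AtomisticToContinuum.Crystallization.Theorems.ExactHcpLocal.site_inj ha0.ne' hh0.ne' h0)
  have memH : ∀ k i j : ℤ, ((k = 0 ∧ -1 ≤ i ∧ i ≤ 1 ∧ -1 ≤ j ∧ j ≤ 1 ∧ -1 ≤ i + j ∧ i + j ≤ 1) ∨
      ((k = 1 ∨ k = -1) ∧ -1 ≤ i ∧ i ≤ 0 ∧ -1 ≤ j ∧ j ≤ 0 ∧ -1 ≤ i + j)) →
      ¬ (k = 0 ∧ i = 0 ∧ j = 0) →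
      barlowPos a₀ h₀ alternatingHagg k i j ∈ templateShell (hcpStacking a₀ h₀) a₀ := fun k i j hL hn =>
    ⟨barlowPos_mem _ _ _, hne k i j hn, (Summit.AtomisticToContinuum.Crystallization.Theorems.ExactHcpLocal.norm_site_lt_iff ha0 hh1 hh2 k i j).2 hL⟩
  -- the same three points are fcc sites (labels of layers `0` and `1` agree)
  have hcf : ∀ i j : ℤ, ∀ k : ℤ, (k = 0 ∨ k = 1) →
      barlowPos a₀ h₀ alternatingHagg k i j = barlowPos a₀ h₀ constHagg k i j := by
    intro i j k hk
    rcases hk with rfl | rfl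
    · simp [barlowPos]
    · simp [barlowPos, hL1]
  have memF : ∀ k i j : ℤ, (k = 0 ∨ k = 1) →
      barlowPos a₀ h₀ alternatingHagg k i j ∈ templateShell (hcpStacking a₀ h₀) a₀ →
      barlowPos a₀ h₀ alternatingHagg k i j ∈ templateShell (fccStacking a₀ h₀) a₀ := by
    intro k i j hk hm
    refine ⟨?_, hm.2.1, hm.2.2⟩
    rw [hcf i j k hk]
    exact barlowPos_mem _ _ _
  have m1 := memH 0 1 0 (by omega) (by omega)
  have m2 := memH 0 0 1 (by omega) (by omega)
  have m3 := memH 1 0 0 (by omega) (by omega)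
  refine ⟨Summit.AtomisticToContinuum.Crystallization.Theorems.ExactHcpLocal.linearIndependent_frame ha0.ne' hh0.ne', ?_, ?_⟩
  · intro i
    fin_cases i
    · exact m1
    · exact m2
    · exact m3
  · intro i
    fin_cases i
    · exact memF 0 1 0 (Or.inl rfl) m1
    · exact memF 0 0 1 (Or.inl rfl) m2
    · exact memF 1 0 0 (Or.inr rfl) m3

/-- **S2 (proof of the registered stub `stub_exactOfForallGood`, readable form).** A point of a
`δ`-separated set that is `η`-good for every `η > 0` has an EXACT template shell: one letter recurs as
`η ↓ 0` (monotonicity), then the Gram limit over a fixed bijection and the frame `u, v, w + h₀e₃` give the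
isometry (two-letter twin of `ExactHcpLocal.exact_cluster`). [folklore] -/
theorem exactOfForallGood_proof (a₀ h₀ δ : ℝ) (ha : 47 / 50 ≤ a₀) (ha' : a₀ ≤ 1)
    (hh : |h₀ - a₀ * Real.sqrt (2 / 3)| ≤ a₀ / 100) (_hδ : 0 < δ) (Y : Set E3)
    (_hYsep : ∀ p ∈ Y, ∀ q ∈ Y, p ≠ q → δ ≤ dist p q)
    (p : E3) (_hp : p ∈ Y) (hgood : ∀ η : ℝ, 0 < η → GoodIn a₀ h₀ η Y p) : ExactShell a₀ h₀ Y p := by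
  classical
  have hb : InBox a₀ h₀ := ⟨ha, ha', hh⟩
  obtain ⟨ha0, -, -⟩ := hb.bounds
  have hr : (0 : ℝ) < 13 / 10 * a₀ := by positivity
  -- one letter for every tolerance
  have hletter : (∀ η : ℝ, 0 < η → ∃ A : E3 →ₗᵢ[ℝ] E3, MatchedWith Y p a₀ η (hcpStacking a₀ h₀) A) ∨
      (∀ η : ℝ, 0 < η → ∃ A : E3 →ₗᵢ[ℝ] E3, MatchedWith Y p a₀ η (fccStacking a₀ h₀) A) := by
    by_contra hcon
    push Not at hcon
    obtain ⟨⟨η₁, hη₁, h1⟩, ⟨η₂, hη₂, h2⟩⟩ := hcon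
    obtain ⟨A, hA | hA⟩ := hgood (min η₁ η₂) (lt_min hη₁ hη₂)
    · exact h1 A (matchedWith_mono hA (min_le_left _ _))
    · exact h2 A (matchedWith_mono hA (min_le_right _ _))
  obtain ⟨hf, hfH, hfF⟩ := frame_mem_templateShell hb
  obtain ⟨hfinH, hfinF⟩ := templateShell_finite hb
  have hTr : ∀ t ∈ shellIn Y p a₀, dist t p < 13 / 10 * a₀ := fun t ht => ht.2.2
  rcases hletter with hH | hF
  · obtain ⟨B, hB⟩ := shell_eq_image_of_forall_eta (T := shellIn Y p a₀)
      (P := templateShell (hcpStacking a₀ h₀) a₀) hfinH hr hTr (fun q hq => hq.2.2) _ hf hfH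
      (fun η hη => hH η hη)
    exact ⟨B, Or.inl hB⟩
  · obtain ⟨B, hB⟩ := shell_eq_image_of_forall_eta (T := shellIn Y p a₀)
      (P := templateShell (fccStacking a₀ h₀) a₀) hfinF hr hTr (fun q hq => hq.2.2) _ hf hfF
      (fun η hη => hF η hη)
    exact ⟨B, Or.inr hB⟩

/-- S2 in the registered (fully inlined) signature. [folklore] -/
theorem exactOfForallGood_inlined : ∀ (a₀ h₀ δ : ℝ), 47 / 50 ≤ a₀ → a₀ ≤ 1 → |h₀ - a₀ * Real.sqrt (2 / 3)| ≤ a₀ / 100 → 0 < δ → ∀ (Y : Set (EuclideanSpace ℝ (Fin 3))), (∀ p ∈ Y, ∀ q ∈ Y, p ≠ q → δ ≤ dist p q) → ∀ p ∈ Y, (∀ η : ℝ, 0 < η → (∃ A : EuclideanSpace ℝ (Fin 3) →ₗᵢ[ℝ] EuclideanSpace ℝ (Fin 3), (∃ e : ↥{z : EuclideanSpace ℝ (Fin 3) | z ∈ Y ∧ z ≠ p ∧ dist z p < 13 / 10 * a₀} ≃ ↥{q : EuclideanSpace ℝ (Fin 3) | q ∈ Literature.MathematicalPhysics.StatisticalMechanics.hcpStacking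 a₀ h₀ ∧ q ≠ 0 ∧ ‖q‖ < 13 / 10 * a₀}, ∀ t : ↥{z : EuclideanSpace ℝ (Fin 3) | z ∈ Y ∧ z ≠ p ∧ dist z p < 13 / 10 * a₀}, dist ((t : EuclideanSpace ℝ (Fin 3)) - p) (A ((e t : ↥{q : EuclideanSpace ℝ (Fin 3) | q ∈ Literature.MathematicalPhysics.StatisticalMechanics.hcpStacking a₀ h₀ ∧ q ≠ 0 ∧ ‖q‖ < 13 / 10 * a₀}) : EuclideanSpace ℝ (Fin 3))) ≤ η) ∨ (∃ e : ↥{z : EuclideanSpace ℝ (Fin 3) | z ∈ Y ∧ z ≠ p ∧ dist z p < 13 / 10 * a₀} ≃ ↥{q : EuclideanSpace ℝ (Fin 3) | q ∈ Literature.MathematicalPhysics.StatisticalMechanics.fccStacking a₀ h₀ ∧ q ≠ 0 ∧ ‖q‖ < 13 / 10 * a₀}, ∀ t : ↥{z : EuclideanSpace ℝ (Fin 3) | z ∈ Y ∧ z ≠ p ∧ dist z p < 13 / 10 * a₀}, dist ((t : EuclideanSpace ℝ (Fin 3)) - p) (A ((e t : ↥{q : EuclideanSpace ℝ (Fin 3)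 | q ∈ Literature.MathematicalPhysics.StatisticalMechanics.fccStacking a₀ h₀ ∧ q ≠ 0 ∧ ‖q‖ < 13 / 10 * a₀}) : EuclideanSpace ℝ (Fin 3))) ≤ η))) → (∃ A : EuclideanSpace ℝ (Fin 3) →ₗᵢ[ℝ] EuclideanSpace ℝ (Fin 3), {z : EuclideanSpace ℝ (Fin 3) | z ∈ Y ∧ z ≠ p ∧ dist z p < 13 / 10 * a₀} = (fun q => p + A q) '' {q : EuclideanSpace ℝ (Fin 3) | q ∈ Literature.MathematicalPhysics.StatisticalMechanics.hcpStacking a₀ h₀ ∧ q ≠ 0 ∧ ‖q‖ < 13 / 10 * a₀} ∨ {z : EuclideanSpace ℝ (Fin 3) | z ∈ Y ∧ z ≠ p ∧ dist z p < 13 / 10 * a₀} = (fun q => p + A q) '' {q : EuclideanSpace ℝ (Fin 3) | q ∈ Literature.MathematicalPhysics.StatisticalMechanics.fccStacking a₀ h₀ ∧ q ≠ 0 ∧ ‖q‖ < 13 / 10 * a₀}) :=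
  exactOfForallGood_proof

/-! ## S3 proved: exact template shells everywhere ⇒ exactly layered at spacing `a₀` (landed chain, re-exported) -/

/-- Exact shells read as bond shells at scale `a₀` with the parameters `(a₀, h₀, h₀)` EXPOSED (the representation
behind `cleanHull_hyps_of_exactShell`). [folklore] -/
theorem bondShell_eq_of_exactShell {a₀ h₀ : ℝ} (hb : InBox a₀ h₀) {Z : Set E3}
    (hZ : ∀ p ∈ Z, ExactShell a₀ h₀ Z p) :
    ∀ p ∈ Z, ∃ (A : E3 →ₗᵢ[ℝ] E3) (t : Bool),
      bondShell a₀ Z p = Set.range (fun k : Fin 12 => p + A (laSlot t a₀ h₀ h₀ k)) := by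
  intro p hp
  obtain ⟨A, t, hA⟩ := (exactShell_iff_laSlot hb).1 (hZ p hp)
  have hband : ∀ w ∈ shellIn Z p a₀, a₀ * (1 - 1 / 50) ≤ dist p w ∧ dist p w ≤ a₀ * (1 + 1 / 50) := by
    intro w hw
    rw [hA] at hw
    obtain ⟨k, rfl⟩ := hw
    have : dist p (p + A (laSlot t a₀ h₀ h₀ k)) = ‖laSlot t a₀ h₀ h₀ k‖ := by
      rw [dist_eq_norm]; simp
    rw [this]
    exact laSlot_norm_band hb t k
  obtain ⟨ha0, -, -⟩ := hb.bounds
  refine ⟨A, t, ?_⟩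
  rw [← hA]
  ext w
  simp only [bondShell, shellIn, Set.mem_setOf_eq]
  constructor
  · rintro ⟨hw, hwp, hd⟩
    refine ⟨hw, hwp, ?_⟩
    rw [dist_comm]; nlinarith
  · rintro ⟨hw, hwp, hd⟩
    exact ⟨hw, hwp, (hband w ⟨hw, hwp, hd⟩).2⟩

/-- **First complete layer at spacing exactly `a₀`.** Re-export of `CleanHull.stub_firstLayer` with the slot
representations supplied by the exact `(a₀, h₀)`-shells, so that the in-plane spacing of the layer is `a₀`
itself: walk in the plane of a rigid site (hexagonal type, or cubic off the ideal ratio) with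
`inplaneStep_of_type`, or — all sites cubic at the ideal ratio — with `stub_cuboctStep`. [folklore] -/
theorem firstLayer_spacing {a₀ h₀ : ℝ} (hb : InBox a₀ h₀) {Z : Set E3} (hne : Z.Nonempty)
    (hZ : ∀ p ∈ Z, ExactShell a₀ h₀ Z p) :
    ∃ p₀ ∈ Z, ∃ A : E3 →ₗᵢ[ℝ] E3,
      ∀ i j : ℤ, A ((i : ℝ) • triangularVec₁ a₀ + (j : ℝ) • triangularVec₂ a₀) + p₀ ∈ Z := by
  obtain ⟨ha0, hlo, hhi⟩ := hb.bounds
  have hh0 : 0 < h₀ := by linarith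
  obtain ⟨hgap, hexact⟩ := cleanHull_hyps_of_exactShell hb hZ
  have rep := bondShell_eq_of_exactShell hb hZ
  by_cases hid : 3 * h₀ ^ 2 = 2 * a₀ ^ 2
  · by_cases hex : ∃ y ∈ Z, ∃ B : E3 →ₗᵢ[ℝ] E3,
        bondShell a₀ Z y = Set.range (fun k : Fin 12 => y + B (laSlot false a₀ h₀ h₀ k))
    · -- a hexagonal site is rigid: walk in its plane
      obtain ⟨y, hy, B, hS⟩ := hex
      refine ⟨y, hy, B, fun i j => ?_⟩
      rw [add_comm]
      exact la_walk Z a₀ a₀ h₀ h₀ ha0 false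
        (fun x F hx hFx => inplaneStep_of_type Z a₀ ha0 hgap hexact x hx a₀ h₀ h₀ F ha0 hh0 hh0 false hFx
          (fun h => absurd h Bool.false_ne_true)) B y hy hS i j
    · -- every site is a perfect cuboctahedron: walk with the cuboctahedral step
      have hall : ∀ y ∈ Z, ∃ (b k : ℝ) (B : E3 →ₗᵢ[ℝ] E3),
          0 < b ∧ 0 < k ∧ 3 * k ^ 2 = 2 * b ^ 2 ∧
          bondShell a₀ Z y = Set.range fun i : Fin 12 => y + B (slotC b k k i) := by
        intro y hy
        obtain ⟨B, t, hS⟩ := rep y hy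
        cases t
        · exact absurd ⟨y, hy, B, hS⟩ hex
        · exact ⟨a₀, h₀, B, ha0, hh0, hid, hS⟩
      obtain ⟨y, hy⟩ := hne
      obtain ⟨b, k, B, -, -, -, hS⟩ := hall y hy
      obtain ⟨B', t', hS'⟩ := rep y hy
      -- use the representation of `y` supplied by `rep` if it is cubic; it is, since `hex` fails
      cases t'
      · exact absurd ⟨y, hy, B', hS'⟩ hex
      · refine ⟨y, hy, B', fun i j => ?_⟩
        rw [add_comm]
        exact la_walk Z a₀ a₀ h₀ h₀ ha0 true
          (fun x F hx hFx => stub_cuboctStep Z a₀ ha0 hall x hx a₀ h₀ F ha0 hh0 hid hFx) B' y hy hS' i j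
  · -- off the ideal ratio every site is rigid
    obtain ⟨y, hy⟩ := hne
    obtain ⟨B, t, hS⟩ := rep y hy
    refine ⟨y, hy, B, fun i j => ?_⟩
    rw [add_comm]
    exact la_walk Z a₀ a₀ h₀ h₀ ha0 t
      (fun x F hx hFx => inplaneStep_of_type Z a₀ ha0 hgap hexact x hx a₀ h₀ h₀ F ha0 hh0 hh0 t hFx
        (fun _ h2 => hid h2.1)) B y hy hS i j

/-- **S3 (proof of the registered stub `stub_exactSlotLayering`, readable form): exact template shells
everywhere ⇒ exactly layered at spacing `a₀` with banded increments.** The `ℤ`-recursion of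
`CleanHull.stub_layeredOfExactShells` re-run from `firstLayer_spacing` (spacing `a₀`) KEEPING the step band
`39/50·a₀ ≤ h ≤ 17/20·a₀` of `stub_layerStepUp/Down`. [folklore] -/
theorem exactSlotLayering_proof (a₀ h₀ : ℝ) (ha : 47 / 50 ≤ a₀) (ha' : a₀ ≤ 1)
    (hh : |h₀ - a₀ * Real.sqrt (2 / 3)| ≤ a₀ / 100) (Z : Set E3) (hne : Z.Nonempty)
    (hZ : ∀ p ∈ Z, ExactShell a₀ h₀ Z p) : ExactlyLayered a₀ Z := by
  classical
  have hb : InBox a₀ h₀ := ⟨ha, ha', hh⟩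
  obtain ⟨ha0, -, -⟩ := hb.bounds
  obtain ⟨hgap, hexact⟩ := cleanHull_hyps_of_exactShell hb hZ
  obtain ⟨p₀, -, A, hL0⟩ := firstLayer_spacing hb hne hZ
  have hlo : a₀ * (1 - 1 / 50) ≤ a₀ := by linarith
  have hhi : a₀ ≤ a₀ * (1 + 1 / 50) := by linarith
  -- layer points and heights
  let pt : ℤ → ℝ → ℤ → ℤ → E3 := fun L z i j =>
    A (((i : ℝ) • triangularVec₁ a₀) + ((j : ℝ) • triangularVec₂ a₀) + ((L : ℝ) • barlowOffset a₀) +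
      (z • layerNormal 1)) + p₀
  let ht : E3 → ℝ := fun x => inner ℝ (x - p₀) (A (layerNormal 1))
  -- one step up / down, as functions on complete layers, keeping the band
  have hup : ∀ q : {Lz : ℤ × ℝ // ∀ i j : ℤ, pt Lz.1 Lz.2 i j ∈ Z},
      ∃ q' : {Lz : ℤ × ℝ // ∀ i j : ℤ, pt Lz.1 Lz.2 i j ∈ Z},
        (q'.1.1 - q.1.1 = 1 ∨ q'.1.1 - q.1.1 = -1) ∧ 39 / 50 * a₀ ≤ q'.1.2 - q.1.2 ∧
        q'.1.2 - q.1.2 ≤ 17 / 20 * a₀ ∧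
        ∀ x ∈ Z, q.1.2 ≤ ht x → ht x < q'.1.2 → ∃ i j : ℤ, x = pt q.1.1 q.1.2 i j := by
    rintro ⟨⟨L, z⟩, hLz⟩
    obtain ⟨ε, h, hε, hlo', hhi', hnext, hexa⟩ := stub_layerStepUp Z a₀ ha0 hgap hexact p₀ a₀ A hlo hhi L z hLz
    refine ⟨⟨(L + ε, z + h), hnext⟩, ?_, ?_, ?_, ?_⟩
    · simpa using hε
    · show 39 / 50 * a₀ ≤ z + h - z
      linarith
    · show z + h - z ≤ 17 / 20 * a₀
      linarith
    · intro x hx h1 h2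
      exact hexa x hx h1 h2
  have hdown : ∀ q : {Lz : ℤ × ℝ // ∀ i j : ℤ, pt Lz.1 Lz.2 i j ∈ Z},
      ∃ q' : {Lz : ℤ × ℝ // ∀ i j : ℤ, pt Lz.1 Lz.2 i j ∈ Z},
        (q.1.1 - q'.1.1 = 1 ∨ q.1.1 - q'.1.1 = -1) ∧ 39 / 50 * a₀ ≤ q.1.2 - q'.1.2 ∧
        q.1.2 - q'.1.2 ≤ 17 / 20 * a₀ ∧
        ∀ x ∈ Z, q'.1.2 ≤ ht x → ht x < q.1.2 → ∃ i j : ℤ, x = pt q'.1.1 q'.1.2 i j := by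
    rintro ⟨⟨L, z⟩, hLz⟩
    obtain ⟨ε, h, hε, hlo', hhi', hnext, hexa⟩ := stub_layerStepDown Z a₀ ha0 hgap hexact p₀ a₀ A hlo hhi L z hLz
    refine ⟨⟨(L + ε, z - h), hnext⟩, ?_, ?_, ?_, ?_⟩
    · rcases hε with rfl | rfl <;> simp
    · show 39 / 50 * a₀ ≤ z - (z - h)
      linarith
    · show z - (z - h) ≤ 17 / 20 * a₀
      linarith
    · intro x hx h1 h2
      exact hexa x hx h1 h2
  choose F hF1 hF2 hF2' hF3 using hup
  choose G hG1 hG2 hG2' hG3 using hdown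
  have h00 : ∀ i j : ℤ, pt 0 0 i j ∈ Z := by
    intro i j
    have := hL0 i j
    simpa [pt] using this
  let q0 : {Lz : ℤ × ℝ // ∀ i j : ℤ, pt Lz.1 Lz.2 i j ∈ Z} := ⟨(0, 0), h00⟩
  let U : ℕ → {Lz : ℤ × ℝ // ∀ i j : ℤ, pt Lz.1 Lz.2 i j ∈ Z} := fun n => F^[n] q0
  let D : ℕ → {Lz : ℤ × ℝ // ∀ i j : ℤ, pt Lz.1 Lz.2 i j ∈ Z} := fun n => G^[n] q0
  let LZ : ℤ → ℤ × ℝ := fun m => Int.rec (fun n => (U n).1) (fun n => (D (n + 1)).1) m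
  have hU : ∀ n : ℕ, U (n + 1) = F (U n) := fun n => Function.iterate_succ_apply' F n q0
  have hD : ∀ n : ℕ, D (n + 1) = G (D n) := fun n => Function.iterate_succ_apply' G n q0
  have hLZ_neg : ∀ n : ℕ, LZ (Int.negSucc n) = (D (n + 1)).1 := fun n => rfl
  -- every layer lies in `Z`
  have hmem : ∀ m i j : ℤ, pt (LZ m).1 (LZ m).2 i j ∈ Z := by
    intro m i j
    cases m with
    | ofNat n => exact (U n).2 i j
    | negSucc n => exact (D (n + 1)).2 i j
  -- consecutive layers
  have hstep : ∀ m : ℤ, ((LZ (m + 1)).1 - (LZ m).1 = 1 ∨ (LZ (m + 1)).1 - (LZ m).1 = -1) ∧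
      (39 / 50 * a₀ ≤ (LZ (m + 1)).2 - (LZ m).2 ∧ (LZ (m + 1)).2 - (LZ m).2 ≤ 17 / 20 * a₀) ∧
      ∀ x ∈ Z, (LZ m).2 ≤ ht x → ht x < (LZ (m + 1)).2 → ∃ i j : ℤ, x = pt (LZ m).1 (LZ m).2 i j := by
    intro m
    cases m with
    | ofNat n =>
      have e0 : LZ (Int.ofNat n) = (U n).1 := rfl
      have e1 : LZ (Int.ofNat n + 1) = (F (U n)).1 := by
        rw [← hU n]; rfl
      rw [e0, e1]
      exact ⟨hF1 (U n), ⟨hF2 (U n), hF2' (U n)⟩, hF3 (U n)⟩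
    | negSucc n =>
      cases n with
      | zero =>
        have e0 : LZ (Int.negSucc 0) = (G q0).1 := by
          rw [hLZ_neg 0, hD 0]; rfl
        have e1 : LZ (Int.negSucc 0 + 1) = q0.1 := rfl
        rw [e0, e1]
        exact ⟨hG1 q0, ⟨hG2 q0, hG2' q0⟩, hG3 q0⟩
      | succ k =>
        have e0 : LZ (Int.negSucc (k + 1)) = (G (D (k + 1))).1 := by
          rw [hLZ_neg (k + 1), hD (k + 1)]
        have e1 : LZ (Int.negSucc (k + 1) + 1) = (D (k + 1)).1 := by
          rw [show Int.negSucc (k + 1) + 1 = Int.negSucc k by rfl, hLZ_neg k]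
        rw [e0, e1]
        exact ⟨hG1 (D (k + 1)), ⟨hG2 (D (k + 1)), hG2' (D (k + 1))⟩, hG3 (D (k + 1))⟩
  -- the Hägg word, the heights, the labels
  let s : ℤ → ℤ := fun m => (LZ (m + 1)).1 - (LZ m).1
  let zf : ℤ → ℝ := fun m => (LZ m).2
  have hHagg : IsHaggSeq s := fun m => (hstep m).1
  have hc : 0 < 39 / 50 * a₀ := by positivity
  have hband : ∀ m : ℤ, 39 / 50 * a₀ ≤ zf (m + 1) - zf m ∧ zf (m + 1) - zf m ≤ 17 / 20 * a₀ :=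
    fun m => (hstep m).2.1
  have hlabel : ∀ m : ℤ, haggLabel s m = (LZ m).1 := by
    intro m
    induction m using Int.induction_on with
    | zero => rw [haggLabel_zero]; rfl
    | succ n ih =>
      rw [haggLabel_succ, ih]
      show (LZ (n : ℤ)).1 + ((LZ ((n : ℤ) + 1)).1 - (LZ (n : ℤ)).1) = (LZ ((n : ℤ) + 1)).1
      omega
    | pred n ih =>
      have h1 := haggLabel_succ s (-(n : ℤ) - 1)
      rw [show -(n : ℤ) - 1 + 1 = -n by ring, ih] at h1
      have : s (-(n : ℤ) - 1) = (LZ (-n)).1 - (LZ (-(n : ℤ) - 1)).1 := by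
        show (LZ (-(n : ℤ) - 1 + 1)).1 - (LZ (-(n : ℤ) - 1)).1 = _
        rw [show -(n : ℤ) - 1 + 1 = -n by ring]
      omega
  -- heights grow at least linearly
  have hgrow : ∀ (m : ℤ) (k : ℕ), zf m + 39 / 50 * a₀ * k ≤ zf (m + k) := by
    intro m k
    induction k with
    | zero => simp
    | succ k ih =>
      have := (hstep (m + k)).2.1.1
      have e : m + ((k + 1 : ℕ) : ℤ) = m + k + 1 := by push_cast; ring
      rw [e]
      push_cast
      linarith
  -- every point of `Z` lies on a layer
  have hcover : ∀ x ∈ Z, ∃ m i j : ℤ, x = pt (LZ m).1 (LZ m).2 i j := by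
    intro x hx
    have hbdd : ∃ b : ℤ, ∀ m : ℤ, zf m ≤ ht x → m ≤ b := by
      obtain ⟨N, hN⟩ := exists_nat_gt ((ht x - zf 0) / (39 / 50 * a₀))
      refine ⟨N, fun m hm => ?_⟩
      by_contra hlt
      push Not at hlt
      obtain ⟨k, rfl⟩ := Int.eq_ofNat_of_zero_le (show (0 : ℤ) ≤ m by omega)
      have hg := hgrow 0 k
      rw [zero_add] at hg
      have hkN : (N : ℝ) < k := by exact_mod_cast (show (N : ℤ) < k from hlt)
      have h2 : (ht x - zf 0) / (39 / 50 * a₀) < k := hN.trans hkN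
      rw [div_lt_iff₀ hc] at h2
      linarith
    have hinh : ∃ m : ℤ, zf m ≤ ht x := by
      obtain ⟨N, hN⟩ := exists_nat_gt ((zf 0 - ht x) / (39 / 50 * a₀))
      refine ⟨-(N : ℤ), ?_⟩
      have hg := hgrow (-(N : ℤ)) N
      rw [show -(N : ℤ) + N = 0 by ring] at hg
      rw [div_lt_iff₀ hc] at hN
      linarith
    obtain ⟨m, hm1, hm2⟩ := Int.exists_greatest_of_bdd hbdd hinh
    have hlt : ht x < zf (m + 1) := by
      by_contra hle
      push Not at hle
      have := hm2 (m + 1) hle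
      omega
    obtain ⟨i, j, hxij⟩ := (hstep m).2.2 x hx hm1 hlt
    exact ⟨m, i, j, hxij⟩
  -- read off
  refine ⟨A, s, zf, p₀, hHagg, hband, ?_⟩
  ext x
  simp only [Set.mem_image, layeredSet, Set.mem_setOf_eq]
  constructor
  · intro hx
    obtain ⟨m, i, j, rfl⟩ := hcover x hx
    exact ⟨_, ⟨m, i, j, rfl⟩, by rw [hlabel m]⟩
  · rintro ⟨_, ⟨m, i, j, rfl⟩, rfl⟩
    rw [hlabel m]
    exact hmem m i j

/-- S3 in the registered (fully inlined) signature. [folklore] -/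
theorem exactSlotLayering_inlined : ∀ (a₀ h₀ : ℝ), 47 / 50 ≤ a₀ → a₀ ≤ 1 → |h₀ - a₀ * Real.sqrt (2 / 3)| ≤ a₀ / 100 → ∀ (Z : Set (EuclideanSpace ℝ (Fin 3))), Z.Nonempty → (∀ p ∈ Z, (∃ A : EuclideanSpace ℝ (Fin 3) →ₗᵢ[ℝ] EuclideanSpace ℝ (Fin 3), {z : EuclideanSpace ℝ (Fin 3) | z ∈ Z ∧ z ≠ p ∧ dist z p < 13 / 10 * a₀} = (fun q => p + A q) '' {q : EuclideanSpace ℝ (Fin 3) | q ∈ Literature.MathematicalPhysics.StatisticalMechanics.hcpStacking a₀ h₀ ∧ q ≠ 0 ∧ ‖q‖ < 13 / 10 * a₀} ∨ {z : EuclideanSpace ℝ (Fin 3) | z ∈ Z ∧ z ≠ p ∧ dist z p < 13 / 10 * a₀} = (fun q => p + A q) '' {q : EuclideanSpace ℝ (Fin 3) | q ∈ Literature.MathematicalPhysics.StatisticalMechanics.fccStacking a₀ h₀ ∧ q ≠ 0 ∧ ‖q‖ < 13 / 10 * a₀})) → (∃ (A : EuclideanSpace ℝ (Fin 3) →ₗᵢ[ℝ]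 EuclideanSpace ℝ (Fin 3)) (s : ℤ → ℤ) (z : ℤ → ℝ) (v : EuclideanSpace ℝ (Fin 3)), Literature.MathematicalPhysics.StatisticalMechanics.IsHaggSeq s ∧ (∀ m : ℤ, 39 / 50 * a₀ ≤ z (m + 1) - z m ∧ z (m + 1) - z m ≤ 17 / 20 * a₀) ∧ Z = (fun q => q + v) '' {q : EuclideanSpace ℝ (Fin 3) | ∃ m i j : ℤ, q = A (((i : ℝ) • Literature.MathematicalPhysics.StatisticalMechanics.triangularVec₁ a₀) + ((j : ℝ) • Literature.MathematicalPhysics.StatisticalMechanics.triangularVec₂ a₀) + ((Literature.MathematicalPhysics.StatisticalMechanics.haggLabel s m : ℝ) • Literature.MathematicalPhysics.StatisticalMechanics.barlowOffset a₀) + (z m • Literature.MathematicalPhysics.StatisticalMechanics.layerNormal 1))}) :=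
  exactSlotLayering_proof

/-! ## The crux, proved -/

/-- **`SpectralChargeLedger.ShellsToLayers` (stmt-AtomisticToContinuum-17254), PROVED**: τ-good hcp/fcc shells on a
large ball give an `(R, ε)`-window of the `LayeredWindows` format — contrapositive compactness in the local rubber
topology (`shellsToLayers_of_closure_exactification_layering`) fed with S1 (`goodOfLimit_inlined`: two-letter shell
congruence passes to local limits), S2 (`exactOfForallGood_inlined`: `∀ η`-goodness is exactness) and S3
(`exactSlotLayering_inlined`: everywhere-exact sets are exactly layered at spacing `a₀`, the landed `CleanHull`
chain re-exported). [folklore] -/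
theorem shellsToLayers_proof :
    Summit.AtomisticToContinuum.Crystallization.Theses.SpectralChargeLedger.ShellsToLayers :=
  shellsToLayers_of_closure_exactification_layering goodOfLimit_inlined exactOfForallGood_inlined
    exactSlotLayering_inlined

end Summit.AtomisticToContinuum.Crystallization.Theorems.ShellsToLayersBlowup

end
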